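import Literature.Computability.AlgebraicComplexity.EquivariantDC
import Literature.Computability.AlgebraicComplexity.StandardFamilies
import Literature.Computability.AlgebraicComplexity.OrbitClosureWeights
import Mathlib.LinearAlgebra.Matrix.Permutation
import Mathlib.GroupTheory.Perm.Cycle.Type
import Mathlib.Data.Int.Order.Units
import Mathlib.Analysis.Complex.Basic
import HarnessLib

/-!
# Forms characterized by their stabilizer (Mulmuley–Sohoni, GCT I/II)

Topic `Literature/Computability/AlgebraicComplexity` (geometric complexity theory; cell
`pub-gct-max`, track T "typed chain", seat lit-1). Honest framing of that cell: multiplicity data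
and certified rank bounds at small parameters; nothing here is a claim on VP vs VNP or P vs NP.

Mulmuley–Sohoni single out the determinant and the permanent among all forms by two properties
of their symmetry groups, which make the "class varieties" `Δ[det_m]`, `Δ[per_n]` (orbit
closures) *group-theoretic* and are the standing hypotheses ("excellent points") of the
representation-theoretic results of GCT II:

* **stability** — the `SL`-orbit of the form is closed. In the tree this is
  `Literature.Computability.AlgebraicComplexity.IsPolystable` (`Polystability.lean`, Bürgisser–
  Ikenmeyer 2017, Def. 2.7) and is PROVED for `det_n` and `per_n`
  (`BurgisserIkenmeyer2017_polystable_det_per_holds`, `PolystabilityProofs.lean`); it is not restated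
  here.
* **characterization by the stabilizer** — the subject of this file.

## Sources, as printed

* K. D. Mulmuley, M. Sohoni, *Geometric complexity theory II: towards explicit obstructions for
  embeddings among class varieties*, SIAM J. Comput. 38 (2008) 1175–1206 = arXiv:cs/0612134, §1
  (journal numbering; = §2 of the arXiv TeX `[tex:cs_0612134 main.tex L221–231]`): "Given a point
  `v ∈ P(V)`, let `v̂ ∈ V` denote a nonzero point on the line representing `v` … Let
  `G_v, G_v̂ ⊆ G` denote the stabilizers of `v` and `v̂`, respectively. We say that `v` is
  characterized by its stabilizer, if `V^{G_v̂}`, the set of points in `V` stabilized by `G_v̂`, is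
  equal to `ℂv`, the line in `V` corresponding to `v`." and **Theorem 2.3** (journal; arXiv
  Thm. 3.3, label `tpart11`, "cf. Part I") `[L788–822]`: "The point `h = perm(X) ∈ P(W)` is stable
  with respect to the action of `SL(X) = SL_k(ℂ)` on `P(W)` … Similarly, `g = det(Y) ∈ P(V)` is
  stable with respect to the action of `G` on `P(V)` … Moreover, both `perm(X) ∈ P(W)` and
  `det(Y) ∈ P(V)` are characterized by their stabilizers. Hence, both `h` and `g` are excellent."
  There `V = Sym^m(Y)`, `Y` an `m × m` variable matrix, `W = Sym^n(X)`, and "All groups in this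
  paper are algebraic and the base field is `ℂ`". [MulmuleySohoniGCT2SIAM2008]
* K. D. Mulmuley, M. Sohoni, *Geometric complexity theory: introduction*, Technical Report
  TR-2007-16, U. Chicago = arXiv:0709.0746, Lecture 13 (scribe notes, "reference: [GCT1]")
  `[tex:0709.0746 Lecture13.tex L125–152]`: "Let `V` be a `G`-module, `G = GL_n(ℂ)` … Let
  `H = G_v` be the stabilizer of `v` … We say that `v` is *characterized by its stabilizer*
  `H = G_v` if `v` is the only point in `P(V)` such that `hv = v, ∀ h ∈ H`." and
  **Proposition** [GCT1] (ibid. `L141–152`): "1. The determinant `g = det(Y) ∈ P(V)` is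
  characterized by its stabilizer. Therefore `Δ_V[g]` is group theoretic. 2. The permanent
  `h = perm(X) ∈ P(W)`, where `W = Sym^n(X)`, is also characterized by its stabilizer. …
  3. Finally, `f = φ(h) ∈ P(V)` is also characterized by its stabilizer." [MulmuleySohoniGCTIntro2007]
* Primary source for both (not held; cite-only): K. D. Mulmuley, M. Sohoni, *Geometric complexity
  theory I: an approach to the P vs. NP and related problems*, SIAM J. Comput. 31 (2001)
  496–526, §4–§5. [MulmuleySohoniSIAM2001]
* Stabilizers themselves: `det` — Frobenius 1897 / Marcus–Moyls 1959, tree fact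
  `Literature.NumberTheory.DiophantineGeometry.frobenius_detPreserver_unimodular_sandwich`
  (`DetStabilizerFrobenius.lean`) with the easy inclusion proved (`linSubst_kronecker_detPoly`,
  `DetStabilizerKronecker.lean`); `per` — GCT II loc. cit. "The stabilizer of `perm(X)` in
  `SL_{n²}(ℂ)` is generated [minc] by linear transformations of the form `X → λ X μ^{-1}` …
  where `λ` and `μ` are either diagonal or permutation matrices" (Marcus–May 1962; since vendored
  and PROVED in `PerStabilizerMarcusMay.lean` / `PerStabilizerMarcusMayProofs.lean`,
  `marcusMay1962_perPreserver_sandwich_holds`).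

## What is vendored, in the tree's conventions

The group `GL σ k` acts on `MvPolynomial σ k` by linear substitution of variables
(`linSubstRep`, `LinSubst.lean`; `(γ · f)(x) = f(γᵀ x)`), `linStabilizer f ≤ GL σ k`
(`EquivariantDC.lean`) is the stabilizer `G_f̂` of the polynomial `f` itself (MS's `v̂`), and the
space `V = Sym^m` of forms of degree `m` is `homogeneousSubmodule σ k m`.

* `fixedForms G f m` — the `k`-submodule `V^{G ∩ G_f̂}` of degree-`m` forms fixed by every
  element of the subgroup `G ≤ GL σ k` that stabilizes `f` (MS's `V^{G_v̂}` for the acting group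
  `G`).
* `IsCharacterizedByStabilizerIn G f m` — every such fixed form is a scalar multiple of `f`
  (MS: "`V^{G_v̂} = ℂ v`"; `isCharacterizedByStabilizerIn_iff_fixedForms_le`: equivalently
  `fixedForms G f m ≤ k ∙ f`). The acting group is a parameter because GCT II takes `G = SL(Y)`
  while the GCT Introduction (Lecture 13) takes `G = GL_ℓ(ℂ)`; enlarging `G` enlarges
  `G ∩ G_f̂` and shrinks the fixed space, so the property is monotone in `G`
  (`IsCharacterizedByStabilizerIn.mono`) and the `GL`-version
  `IsCharacterizedByStabilizer f m := IsCharacterizedByStabilizerIn ⊤ f m` is the weakest one.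
* NAMED FACTS (D-0014), the `GL`-reading of the printed statements for the tree's generic
  determinant `detPoly (Fin m) ℂ` (degree `m`, variables `Fin m × Fin m`) and generic permanent
  `perPoly (Fin n) ℂ`: `detPoly_isCharacterizedByStabilizer`, `perPoly_isCharacterizedByStabilizer`.
  Both hold for every size (for `m = 0, 1` trivially). They are stated over `ℂ` as printed and
  DISCHARGED below (`perPoly_isCharacterizedByStabilizer_holds`,
  `detPoly_isCharacterizedByStabilizer_holds`, via `CharacterizedByStabilizer.perPoly_eq_smul_of_fixed`
  / `detPoly_eq_smul_of_fixed` over any field of characteristic zero) by an elementary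
  torus-weight / signed-row-permutation argument; `fixedForms_detPoly_eq`, `fixedForms_perPoly_eq`
  are the unconditional forms `V^{G_f̂} = ℂ f`.
* PROVED, clause (3) of the Lecture 13 Proposition (GCT II Thm. 2.3's `f = φ(h)`): the padded
  permanent `paddedPerPoly ℂ n m = X₀₀^{m-n} · per_n` (`per_n` on the bottom-right block,
  `OrbitClosure.lean`), `n < m`, is characterized by its stabilizer in `GL_{m²}` —
  `paddedPerPoly_isCharacterizedByStabilizer`, `fixedForms_paddedPerPoly_eq`, via
  `CharacterizedByStabilizer.paddedPerPoly_eq_smul_of_fixed` (any field of characteristic zero);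
  a theorem, no named fact (last section of this file).

* The `SL(Y)`-reading of GCT II §1/Thm. 2.3 for the permanent itself (a stronger statement than
  the Introduction's `GL` one) is GROUP-SENSITIVE: PROVED here in hypothesis form for `n` even or
  `n ≡ 3 (mod 4)` (`CharacterizedByStabilizer.perPoly_eq_smul_of_fixed_of_det_eq_one`, last
  section: a degree-`n` form fixed by every determinant-one substitution fixing `per_n` is a
  multiple of `per_n`), and REFUTED for `n ≡ 1 (mod 4)`, `n ≥ 5`, in the companion file
  `CharacterizedByStabilizerSL.lean` (`not_isCharacterizedByStabilizerIn_slSubgroup_perPoly`: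
  `det_n` is also fixed), which restates both halves for the subgroup `slSubgroup = SL_{n²}`.

* The `SL(Y)`-reading for the determinant holds literally, for every `m`
  (`CharacterizedByStabilizer.detPoly_eq_smul_of_fixed_of_det_eq_one`, hypothesis form; the
  generators of the `GL` proof already have determinant `1`); restated for `slSubgroup` in the
  companion file.

* The `SL(Y)`-reading for the padded permanent holds literally for `n < m`, `m ≥ 3`
  (`CharacterizedByStabilizer.paddedPerPoly_eq_smul_of_fixed_of_det_eq_one`, hypothesis form, last
  section: determinant-one scalings of pairs of the variables absent from `X₀₀^{m-n} per_n` reduce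
  it to the `GL` statement); restated for `slSubgroup` in the companion file. The degenerate sizes
  `m ≤ 2` are not treated.

Not vendored: the projective variant
"`v` is the only point of `P(V)` fixed by `G_v`" of Lecture 13 (fixed *lines* of the projective
stabilizer), MS's "excellent" (= stable or partially stable with defect zero, and characterized by
the stabilizer; partial stability needs Kempf's destabilizing flag, absent from the tree), and the
descriptions of the two stabilizer groups (see above).
-/

noncomputable section

open MvPolynomial Finset

namespace Literature.Computability.AlgebraicComplexity

universe u v

variable {k : Type u} [CommRing k] {σ : Type v} [Fintype σ] [DecidableEq σ]

/-! ## Fixed forms of the stabilizer and the characterization property -/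

/-- `V^{G ∩ G_f̂}`: the degree-`m` forms `p` with `γ · p = p` for every `γ` in the subgroup `G`
that stabilizes `f` (`γ · f = f`), as a `k`-submodule of `MvPolynomial σ k`. Mulmuley–Sohoni
2008, §1 ("`V^{G_v̂}`, the set of points in `V` stabilized by `G_v̂`", `V = Sym^m`).
[cite: MulmuleySohoniGCT2SIAM2008, §1 (definition of "characterized by its stabilizer")] -/
def fixedForms (G : Subgroup (GL σ k)) (f : MvPolynomial σ k) (m : ℕ) :
    Submodule k (MvPolynomial σ k) where
  carrier := {p | p ∈ homogeneousSubmodule σ k m ∧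
    ∀ γ ∈ G ⊓ linStabilizer f, linSubstRep σ k γ p = p}
  zero_mem' := ⟨Submodule.zero_mem _, fun γ _ => map_zero _⟩
  add_mem' {p q} hp hq := ⟨Submodule.add_mem _ hp.1 hq.1, fun γ hγ => by
    rw [map_add, hp.2 γ hγ, hq.2 γ hγ]⟩
  smul_mem' c {p} hp := ⟨Submodule.smul_mem _ c hp.1, fun γ hγ => by
    rw [map_smul, hp.2 γ hγ]⟩

omit [DecidableEq σ] in
/-- Membership in `fixedForms`: a degree-`m` form fixed by every element of `G` stabilizing `f`.
[cite: MulmuleySohoniGCT2SIAM2008, §1 (definition of "characterized by its stabilizer")] -/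
theorem mem_fixedForms_iff [DecidableEq σ] {G : Subgroup (GL σ k)} {f : MvPolynomial σ k} {m : ℕ}
    {p : MvPolynomial σ k} :
    p ∈ fixedForms G f m ↔ p.IsHomogeneous m ∧
      ∀ γ ∈ G, linSubstRep σ k γ f = f → linSubstRep σ k γ p = p := by
  change (p ∈ homogeneousSubmodule σ k m ∧ ∀ γ ∈ G ⊓ linStabilizer f, _) ↔ _
  simp only [mem_homogeneousSubmodule, Subgroup.mem_inf, mem_linStabilizer, and_imp]

/-- **`f` is characterized by its stabilizer in `G`** (Mulmuley–Sohoni 2008, §1: "`v` is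
characterized by its stabilizer, if `V^{G_v̂}` … is equal to `ℂv`"), for the action of a subgroup
`G ≤ GL σ k` by linear substitution on the space `V = Sym^m` of degree-`m` forms: every form of
degree `m` fixed by all `γ ∈ G` with `γ · f = f` is a scalar multiple of `f`. GCT II takes
`G = SL(Y)`; the GCT Introduction (arXiv:0709.0746, Lecture 13) takes `G = GL`.
[cite: MulmuleySohoniGCT2SIAM2008, §1 (definition of "characterized by its stabilizer")] -/
def IsCharacterizedByStabilizerIn (G : Subgroup (GL σ k)) (f : MvPolynomial σ k) (m : ℕ) :
    Prop :=
  ∀ p : MvPolynomial σ k, p.IsHomogeneous m →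
    (∀ γ ∈ G, linSubstRep σ k γ f = f → linSubstRep σ k γ p = p) → ∃ c : k, p = c • f

/-- **`f` is characterized by its stabilizer** for the full group `GL σ k` of linear substitutions
(the reading of Mulmuley–Sohoni, *GCT: Introduction*, Lecture 13: "`G = GL_n(ℂ)` … `v` is
characterized by its stabilizer `H = G_v`"): `IsCharacterizedByStabilizerIn ⊤ f m`.
[cite: MulmuleySohoniGCTIntro2007, Lecture 13 (definition before Prop. [GCT1])] -/
abbrev IsCharacterizedByStabilizer (f : MvPolynomial σ k) (m : ℕ) : Prop :=
  IsCharacterizedByStabilizerIn ⊤ f m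

/-- MS's formulation as an inclusion of subspaces: `f` is characterized by its stabilizer in `G`
iff `V^{G ∩ G_f̂} ⊆ k ∙ f`. [cite: MulmuleySohoniGCT2SIAM2008, §1 (definition of "characterized by its stabilizer")] -/
theorem isCharacterizedByStabilizerIn_iff_fixedForms_le {G : Subgroup (GL σ k)}
    {f : MvPolynomial σ k} {m : ℕ} :
    IsCharacterizedByStabilizerIn G f m ↔ fixedForms G f m ≤ k ∙ f := by
  constructor
  · intro h p hp
    rw [mem_fixedForms_iff] at hp
    obtain ⟨c, rfl⟩ := h p hp.1 hp.2
    exact Submodule.mem_span_singleton.mpr ⟨c, rfl⟩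
  · intro h p hp hfix
    obtain ⟨c, hc⟩ := Submodule.mem_span_singleton.mp (h (mem_fixedForms_iff.mpr ⟨hp, hfix⟩))
    exact ⟨c, hc.symm⟩

/-- If `f` is itself a form of degree `m`, characterization means `V^{G ∩ G_f̂} = k ∙ f` exactly
(MS: "`V^{G_v̂}` … is equal to `ℂv`"). [cite: MulmuleySohoniGCT2SIAM2008, §1 (definition of "characterized by its stabilizer")] -/
theorem IsCharacterizedByStabilizerIn.fixedForms_eq {G : Subgroup (GL σ k)} {f : MvPolynomial σ k}
    {m : ℕ} (h : IsCharacterizedByStabilizerIn G f m) (hf : f.IsHomogeneous m) :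
    fixedForms G f m = k ∙ f := by
  refine le_antisymm (isCharacterizedByStabilizerIn_iff_fixedForms_le.mp h) ?_
  rw [Submodule.span_le, Set.singleton_subset_iff]
  exact mem_fixedForms_iff.mpr ⟨hf, fun γ _ hγ => hγ⟩

/-- Monotonicity in the acting group: enlarging `G` enlarges `G ∩ G_f̂`, so a form characterized
by its stabilizer in `G` is characterized by its stabilizer in every `G' ≥ G`; in particular the
`SL`-statement of GCT II §1 implies the `GL`-statement of the Introduction (immediate from the
definition, Mulmuley–Sohoni 2008 §1). [cite: MulmuleySohoniGCT2SIAM2008, §1 (definition of "characterized by its stabilizer")] -/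
theorem IsCharacterizedByStabilizerIn.mono {G G' : Subgroup (GL σ k)} (hGG' : G ≤ G')
    {f : MvPolynomial σ k} {m : ℕ} (h : IsCharacterizedByStabilizerIn G f m) :
    IsCharacterizedByStabilizerIn G' f m :=
  fun p hp hfix => h p hp fun γ hγ hγf => hfix γ (hGG' hγ) hγf

/-- In any acting group, `IsCharacterizedByStabilizerIn G f m` yields the `GL`-version (immediate
from the definition, Mulmuley–Sohoni 2008 §1; GCT Introduction, Lecture 13).
[cite: MulmuleySohoniGCTIntro2007, Lecture 13 (definition before Prop. [GCT1])] -/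
theorem IsCharacterizedByStabilizerIn.isCharacterizedByStabilizer {G : Subgroup (GL σ k)}
    {f : MvPolynomial σ k} {m : ℕ} (h : IsCharacterizedByStabilizerIn G f m) :
    IsCharacterizedByStabilizer f m :=
  h.mono le_top

/-! ## The two named facts (Mulmuley–Sohoni 2001/2008; GCT Introduction, Lecture 13) -/

/-- **The determinant is characterized by its stabilizer** (Mulmuley–Sohoni 2008, Thm. 2.3
(journal; arXiv Thm. 3.3) "`det(Y) ∈ P(V)` [is] characterized by [its] stabilizer", "cf. Part I"
= Mulmuley–Sohoni 2001; GCT Introduction, Lecture 13, Prop. [GCT1](1): "The determinant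
`g = det(Y) ∈ P(V)` is characterized by its stabilizer. Therefore `Δ_V[g]` is group theoretic"),
in the `GL`-reading and the tree's conventions: for every `m`, every form of degree `m` in the
`m²` matrix variables over `ℂ` that is fixed by every `γ ∈ GL_{m²}(ℂ)` fixing the generic
determinant `detPoly (Fin m) ℂ` under linear substitution is a scalar multiple of `det_m`.
Named fact (D-0014); users take `(h : detPoly_isCharacterizedByStabilizer)`.
[cite: MulmuleySohoniGCT2SIAM2008, Thm. 2.3 (arXiv cs/0612134 Thm. 3.3)]
[cite: MulmuleySohoniGCTIntro2007, Lecture 13, Prop. [GCT1](1)] [cite: MulmuleySohoniSIAM2001, §4] -/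
def detPoly_isCharacterizedByStabilizer : Prop :=
  ∀ m : ℕ, IsCharacterizedByStabilizer (detPoly (Fin m) ℂ) m

/-- **The permanent is characterized by its stabilizer** (Mulmuley–Sohoni 2008, Thm. 2.3
(journal; arXiv Thm. 3.3) "both `perm(X) ∈ P(W)` and `det(Y) ∈ P(V)` are characterized by their
stabilizers", "cf. Part I" = Mulmuley–Sohoni 2001; GCT Introduction, Lecture 13,
Prop. [GCT1](2): "The permanent `h = perm(X) ∈ P(W)`, where `W = Sym^n(X)`, is also characterized
by its stabilizer. Therefore `Δ_W[h]` is also group theoretic"), in the `GL`-reading and the tree's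
conventions: for every `n`, every form of degree `n` in the `n²` matrix variables over `ℂ` that is
fixed by every `γ ∈ GL_{n²}(ℂ)` fixing the generic permanent `perPoly (Fin n) ℂ` under linear
substitution is a scalar multiple of `per_n`. Named fact (D-0014); users take
`(h : perPoly_isCharacterizedByStabilizer)`.
[cite: MulmuleySohoniGCT2SIAM2008, Thm. 2.3 (arXiv cs/0612134 Thm. 3.3)]
[cite: MulmuleySohoniGCTIntro2007, Lecture 13, Prop. [GCT1](2)] [cite: MulmuleySohoniSIAM2001, §4] -/
def perPoly_isCharacterizedByStabilizer : Prop :=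
  ∀ n : ℕ, IsCharacterizedByStabilizer (perPoly (Fin n) ℂ) n

/-- Unfolding of the determinant fact at one size, in the "fixed forms ⊆ line" form.
[cite: MulmuleySohoniGCT2SIAM2008, Thm. 2.3 (arXiv cs/0612134 Thm. 3.3)] -/
theorem detPoly_isCharacterizedByStabilizer.fixedForms_eq (h : detPoly_isCharacterizedByStabilizer)
    (m : ℕ) : fixedForms ⊤ (detPoly (Fin m) ℂ) m = ℂ ∙ detPoly (Fin m) ℂ :=
  (h m).fixedForms_eq (by simpa using (detPoly_isHomogeneous (n := Fin m) (k := ℂ)))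

/-- Unfolding of the permanent fact at one size, in the "fixed forms ⊆ line" form.
[cite: MulmuleySohoniGCT2SIAM2008, Thm. 2.3 (arXiv cs/0612134 Thm. 3.3)] -/
theorem perPoly_isCharacterizedByStabilizer.fixedForms_eq (h : perPoly_isCharacterizedByStabilizer)
    (n : ℕ) : fixedForms ⊤ (perPoly (Fin n) ℂ) n = ℂ ∙ perPoly (Fin n) ℂ :=
  (h n).fixedForms_eq (by simpa using (perPoly_isHomogeneous (n := Fin n) (k := ℂ)))

/-! ## Discharge of the two named facts

An elementary proof, different from the classical route (Frobenius / Marcus–May descriptions of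
the full stabilizers): only diagonal substitutions and (signed) row permutations inside the
stabilizer are used. Helper declarations are `private`. -/

end Literature.Computability.AlgebraicComplexity

namespace Literature.Computability.AlgebraicComplexity

namespace CharacterizedByStabilizer

variable {k : Type*} [Field k] {n : ℕ}



/-! ### Permutation exponents -/

/-- The exponent vector of the permutation monomial `∏ i, X (π i, i)`. [folklore] -/
private def permExp (π : Equiv.Perm (Fin n)) : (Fin n × Fin n) →₀ ℕ :=
  ∑ i, Finsupp.single (π i, i) 1

/-- Value of a permutation exponent at a variable index. [folklore] -/
private theorem permExp_apply (π : Equiv.Perm (Fin n)) (x : Fin n × Fin n) :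
    permExp π x = if π x.2 = x.1 then 1 else 0 := by
  unfold permExp
  rw [Finsupp.finsetSum_apply]
  simp only [Finsupp.single_apply]
  rcases x with ⟨a, b⟩
  rw [Finset.sum_eq_single b]
  · simp only [Prod.mk.injEq, and_true]
  · intro i _ hib
    rw [if_neg]
    simp only [Prod.mk.injEq, not_and]
    exact fun _ => hib
  · intro h; exact absurd (Finset.mem_univ b) h

/-- Distinct permutations have distinct permutation monomials. [folklore] -/
private theorem permExp_injective : Function.Injective (permExp (n := n)) := by
  intro π π' h
  ext i
  have := congrArg (fun e => e (π i, i)) h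
  simp only [permExp_apply, if_true] at this
  by_contra hne
  rw [if_neg (fun h' => hne (congrArg Fin.val h'.symm))] at this
  exact one_ne_zero this

/-- `∏ i, X (π i, i)` is the monomial with exponent `permExp π`. [folklore] -/
private theorem prod_X_eq_monomial_permExp (π : Equiv.Perm (Fin n)) :
    (∏ i, X (π i, i) : MvPolynomial (Fin n × Fin n) k) = monomial (permExp π) 1 := by
  rw [permExp, monomial_sum_one]
  rfl

/-- The generic permanent as a sum of permutation monomials (Leibniz expansion). [folklore] -/
private theorem perPoly_eq_sum (n : ℕ) :
    perPoly (Fin n) k = ∑ π : Equiv.Perm (Fin n), monomial (permExp π) 1 := by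
  unfold perPoly Matrix.permanent
  refine Finset.sum_congr rfl fun π _ => ?_
  rw [← prod_X_eq_monomial_permExp]
  rfl

/-- The generic determinant as a signed sum of permutation monomials (Leibniz expansion). [folklore] -/
private theorem detPoly_eq_sum (n : ℕ) :
    detPoly (Fin n) k = ∑ π : Equiv.Perm (Fin n),
      ((Equiv.Perm.sign π : ℤ) : k) • monomial (permExp π) 1 := by
  unfold detPoly
  rw [Matrix.det_apply']
  refine Finset.sum_congr rfl fun π _ => ?_
  rw [← prod_X_eq_monomial_permExp, Algebra.smul_def, algebraMap_eq]
  simp [Matrix.mvPolynomialX, map_intCast]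


/-! ### Diagonal substitutions and coefficients -/

section Diagonal

variable {σ : Type*} [Fintype σ] [DecidableEq σ]

omit [DecidableEq σ] in
/-- A `Finsupp.prod` of powers over a finite type is the product over all indices. [folklore] -/
private theorem prod_pow_eq_finsuppProd (β : σ → k) (e : σ →₀ ℕ) :
    (e.prod fun x m => β x ^ m) = ∏ x, β x ^ e x :=
  Finsupp.prod_fintype _ _ fun _ => pow_zero _

/-- A diagonal substitution scales the coefficient of `X^e` by `∏ β_x^{e x}` (torus weights of monomials). [folklore] -/
private theorem coeff_linSubst_diagonal (β : σ → k) (p : MvPolynomial σ k) (e : σ →₀ ℕ) :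
    coeff e (linSubst σ k (Matrix.diagonal β) p) = (∏ x, β x ^ e x) * coeff e p := by
  conv_lhs => rw [p.as_sum, map_sum]
  simp only [linSubst_diagonal_monomial, prod_pow_eq_finsuppProd, coeff_sum, coeff_smul,
    coeff_monomial, smul_eq_mul, mul_ite, mul_zero]
  rw [Finset.sum_ite_eq']
  split_ifs with h
  · rfl
  · rw [MvPolynomial.notMem_support_iff.mp h, mul_zero]

/-- The diagonal matrix with nonzero entries `β` as an element of `GL`. [folklore] -/
private def diagGL (β : σ → k) (hβ : ∀ x, β x ≠ 0) : GL σ k :=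
  Matrix.GeneralLinearGroup.mkOfDetNeZero (Matrix.diagonal β)
    (by rw [Matrix.det_diagonal]; exact Finset.prod_ne_zero_iff.mpr fun x _ => hβ x)

/-- Underlying matrix of `diagGL`. [folklore] -/
@[simp] private theorem coe_diagGL (β : σ → k) (hβ : ∀ x, β x ≠ 0) :
    ((diagGL β hβ : GL σ k) : Matrix σ σ k) = Matrix.diagonal β :=
  Matrix.GeneralLinearGroup.val_mkOfDetNeZero _ _

/-- A permutation of the variables as an element of `GL`, acting by `rename θ`. [folklore] -/
private def permGL (θ : Equiv.Perm σ) : GL σ k :=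
  Matrix.GeneralLinearGroup.mkOfDetNeZero (θ⁻¹.permMatrix k) (by
    rw [Matrix.det_permutation]
    rcases Int.units_eq_one_or (Equiv.Perm.sign θ⁻¹) with h | h <;> simp [h])

/-- `permGL θ` acts by renaming the variables along `θ`. [folklore] -/
private theorem linSubstRep_permGL (θ : Equiv.Perm σ) (q : MvPolynomial σ k) :
    linSubstRep σ k (permGL θ) q = rename θ q := by
  rw [linSubstRep_apply, permGL, Matrix.GeneralLinearGroup.val_mkOfDetNeZero, linSubst_permMatrix,
    Equiv.Perm.inv_def, Equiv.symm_symm]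

/-- `diagGL β` acts by the diagonal substitution. [folklore] -/
private theorem linSubstRep_diagGL (β : σ → k) (hβ : ∀ x, β x ≠ 0) (q : MvPolynomial σ k) :
    linSubstRep σ k (diagGL β hβ) q = linSubst σ k (Matrix.diagonal β) q := by
  rw [linSubstRep_apply, coe_diagGL]

end Diagonal

/-! ### Row/column scalings fixing `per` and `det` -/

/-- Row sum `∑_b e(a,b)` of an exponent matrix. [folklore] -/
private def rowSum (e : (Fin n × Fin n) →₀ ℕ) (a : Fin n) : ℕ := ∑ b, e (a, b)

/-- Column sum `∑_a e(a,b)` of an exponent matrix. [folklore] -/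
private def colSum (e : (Fin n × Fin n) →₀ ℕ) (b : Fin n) : ℕ := ∑ a, e (a, b)

/-- The torus weight scaling row class `a` by `2` and column class `b` by `2⁻¹`. [folklore] -/
private def rcWeight (a b : Fin n) (x : Fin n × Fin n) : k :=
  (if x.1 = a then 2 else 1) * (if x.2 = b then 2⁻¹ else 1)

/-- The row/column scaling weights are nonzero in characteristic zero. [folklore] -/
private theorem rcWeight_ne_zero [CharZero k] (a b : Fin n) (x : Fin n × Fin n) :
    rcWeight (k := k) a b x ≠ 0 := by
  unfold rcWeight
  refine mul_ne_zero ?_ ?_ <;> split_ifs <;> simp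

/-- The character of the row/column scaling on `X^e` is `2^{rowSum e a} · 2^{-colSum e b}`. [folklore] -/
private theorem prod_rcWeight_pow (a b : Fin n) (e : (Fin n × Fin n) →₀ ℕ) :
    ∏ x, rcWeight (k := k) a b x ^ e x = 2 ^ rowSum e a * (2⁻¹) ^ colSum e b := by
  simp only [rcWeight, mul_pow, Finset.prod_mul_distrib, ite_pow, one_pow]
  congr 1
  · rw [Fintype.prod_prod_type]
    have h : ∀ x : Fin n, (∏ y : Fin n, if x = a then (2 : k) ^ e (x, y) else 1) =
        if x = a then (2 : k) ^ rowSum e x else 1 := fun x => by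
      split_ifs <;> simp [rowSum, Finset.prod_pow_eq_pow_sum]
    simp_rw [h]
    rw [Finset.prod_ite_eq']
    simp
  · rw [Fintype.prod_prod_type_right]
    have h : ∀ y : Fin n, (∏ x : Fin n, if y = b then (2⁻¹ : k) ^ e (x, y) else 1) =
        if y = b then (2⁻¹ : k) ^ colSum e y else 1 := fun y => by
      split_ifs <;> simp [colSum, Finset.prod_pow_eq_pow_sum]
    simp_rw [h]
    rw [Finset.prod_ite_eq']
    simp

/-- The character of a diagonal substitution on a permutation monomial. [folklore] -/
private theorem prod_pow_permExp (β : Fin n × Fin n → k) (π : Equiv.Perm (Fin n)) :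
    ∏ x, β x ^ permExp π x = ∏ i, β (π i, i) := by
  simp only [permExp_apply, pow_ite, pow_one, pow_zero]
  rw [Fintype.prod_prod_type_right]
  refine Finset.prod_congr rfl fun b _ => ?_
  simp only []
  rw [Finset.prod_ite_eq]
  simp

/-- Permutation monomials are fixed by the row/column scalings. [folklore] -/
private theorem prod_rcWeight_permExp [CharZero k] (a b : Fin n) (π : Equiv.Perm (Fin n)) :
    ∏ i, rcWeight (k := k) a b (π i, i) = 1 := by
  simp only [rcWeight, Finset.prod_mul_distrib]
  have h1 : ∏ i, (if π i = a then (2 : k) else 1) = 2 := by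
    simp_rw [show ∀ i, (π i = a ↔ i = π.symm a) from fun i => π.apply_eq_iff_eq_symm_apply (y := a)]
    rw [Finset.prod_ite_eq']; simp
  have h2 : ∏ i, (if i = b then (2⁻¹ : k) else 1) = 2⁻¹ := by
    rw [Finset.prod_ite_eq']; simp
  rw [h1, h2]
  exact mul_inv_cancel₀ two_ne_zero


/-! ### Fixedness under the row/column scalings forces permutation-pattern support -/

section Support

variable {σ : Type*} [Fintype σ] [DecidableEq σ]

/-- Diagonal substitution on a monomial, product over all indices. [folklore] -/
private theorem linSubst_diagonal_monomial' (β : σ → k) (e : σ →₀ ℕ) (c : k) :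
    linSubst σ k (Matrix.diagonal β) (monomial e c) = (∏ x, β x ^ e x) • monomial e c := by
  rw [linSubst_diagonal_monomial, prod_pow_eq_finsuppProd]

/-- If a diagonal substitution fixes `p`, its character is `1` on every monomial of `p`. [folklore] -/
private theorem prod_pow_eq_one_of_fixed {β : σ → k} {p : MvPolynomial σ k}
    (hfix : linSubst σ k (Matrix.diagonal β) p = p) {e : σ →₀ ℕ} (he : e ∈ p.support) :
    ∏ x, β x ^ e x = 1 := by
  have h := congrArg (coeff e) hfix
  rw [coeff_linSubst_diagonal] at h
  exact (mul_eq_right₀ (mem_support_iff.mp he)).mp h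

end Support

/-- The row/column scalings fix every permutation monomial. [folklore] -/
private theorem linSubst_rcDiag_monomial_permExp [CharZero k] (a b : Fin n) (π : Equiv.Perm (Fin n))
    (c : k) :
    linSubst _ k (Matrix.diagonal (rcWeight a b)) (monomial (permExp π) c) =
      monomial (permExp π) c := by
  rw [linSubst_diagonal_monomial', prod_pow_permExp, prod_rcWeight_permExp, one_smul]

/-- The row/column scalings fix the permanent. [folklore] -/
private theorem linSubst_rcDiag_perPoly [CharZero k] (a b : Fin n) :
    linSubst _ k (Matrix.diagonal (rcWeight a b)) (perPoly (Fin n) k) = perPoly (Fin n) k := by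
  rw [perPoly_eq_sum, map_sum]
  simp_rw [linSubst_rcDiag_monomial_permExp]

/-- The row/column scalings fix the determinant. [folklore] -/
private theorem linSubst_rcDiag_detPoly [CharZero k] (a b : Fin n) :
    linSubst _ k (Matrix.diagonal (rcWeight a b)) (detPoly (Fin n) k) = detPoly (Fin n) k := by
  rw [detPoly_eq_sum, map_sum]
  simp_rw [map_smul, linSubst_rcDiag_monomial_permExp]

/-- Fixedness under the `(a,b)` scaling forces `rowSum e a = colSum e b` on the support. [folklore] -/
private theorem rowSum_eq_colSum [CharZero k] {p : MvPolynomial (Fin n × Fin n) k} (a b : Fin n)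
    (hfix : linSubst _ k (Matrix.diagonal (rcWeight a b)) p = p) {e : (Fin n × Fin n) →₀ ℕ}
    (he : e ∈ p.support) : rowSum e a = colSum e b := by
  have h := prod_pow_eq_one_of_fixed hfix he
  rw [prod_rcWeight_pow, inv_pow, mul_inv_eq_one₀ (pow_ne_zero _ two_ne_zero)] at h
  have h' : ((2 ^ rowSum e a : ℕ) : k) = ((2 ^ colSum e b : ℕ) : k) := by push_cast; exact h
  exact Nat.pow_right_injective le_rfl (Nat.cast_injective h')

/-- The degree of an exponent matrix is the sum of its row sums. [folklore] -/
private theorem degree_eq_sum_rowSum (e : (Fin n × Fin n) →₀ ℕ) : e.degree = ∑ a, rowSum e a := by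
  rw [Finsupp.degree_eq_sum, Fintype.sum_prod_type]; rfl

/-- The degree of an exponent matrix is the sum of its column sums. [folklore] -/
private theorem degree_eq_sum_colSum (e : (Fin n × Fin n) →₀ ℕ) : e.degree = ∑ b, colSum e b := by
  rw [Finsupp.degree_eq_sum, Fintype.sum_prod_type_right]; rfl

/-- Monomials of a form of degree `n` have degree `n`. [folklore] -/
private theorem degree_eq_of_mem_support {p : MvPolynomial (Fin n × Fin n) k} (hp : p.IsHomogeneous n)
    {e : (Fin n × Fin n) →₀ ℕ} (he : e ∈ p.support) : e.degree = n := by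
  by_contra h
  exact (mem_support_iff.mp he) (hp.coeff_eq_zero h)

/-- All row sums of a monomial of a fixed form of degree `n` are `1`. [folklore] -/
private theorem rowSum_eq_one [CharZero k] {p : MvPolynomial (Fin n × Fin n) k} (hp : p.IsHomogeneous n)
    (hfix : ∀ a b : Fin n, linSubst _ k (Matrix.diagonal (rcWeight a b)) p = p)
    {e : (Fin n × Fin n) →₀ ℕ} (he : e ∈ p.support) (a : Fin n) : rowSum e a = 1 := by
  have hcol : ∀ b, colSum e b = rowSum e a := fun b => (rowSum_eq_colSum a b (hfix a b) he).symm
  have hsum : ∑ b : Fin n, colSum e b = n := by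
    rw [← degree_eq_sum_colSum, degree_eq_of_mem_support hp he]
  simp only [hcol, Finset.sum_const, Finset.card_univ, Fintype.card_fin, smul_eq_mul] at hsum
  exact Nat.eq_of_mul_eq_mul_left (Fin.pos a) (by rw [mul_one]; exact hsum)

/-- All column sums of a monomial of a fixed form of degree `n` are `1`. [folklore] -/
private theorem colSum_eq_one [CharZero k] {p : MvPolynomial (Fin n × Fin n) k} (hp : p.IsHomogeneous n)
    (hfix : ∀ a b : Fin n, linSubst _ k (Matrix.diagonal (rcWeight a b)) p = p)
    {e : (Fin n × Fin n) →₀ ℕ} (he : e ∈ p.support) (b : Fin n) : colSum e b = 1 := by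
  have hrow : ∀ a, rowSum e a = colSum e b := fun a => rowSum_eq_colSum a b (hfix a b) he
  have hsum : ∑ a : Fin n, rowSum e a = n := by
    rw [← degree_eq_sum_rowSum, degree_eq_of_mem_support hp he]
  simp only [hrow, Finset.sum_const, Finset.card_univ, Fintype.card_fin, smul_eq_mul] at hsum
  exact Nat.eq_of_mul_eq_mul_left (Fin.pos b) (by rw [mul_one]; exact hsum)

/-! ### Exponent matrices with unit row and column sums are permutation patterns -/

/-- A family of naturals summing to `1` is a single `1`. [folklore] -/
private theorem exists_eq_one_of_sum_eq_one {ι : Type*} [Fintype ι] [DecidableEq ι] (f : ι → ℕ)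
    (h : ∑ i, f i = 1) : ∃ i, f i = 1 ∧ ∀ j, j ≠ i → f j = 0 := by
  obtain ⟨i, -, hi⟩ := Finset.exists_ne_zero_of_sum_ne_zero (h.symm ▸ one_ne_zero : ∑ i, f i ≠ 0)
  have hsplit := Finset.add_sum_erase Finset.univ f (Finset.mem_univ i)
  rw [h] at hsplit
  have hfi : f i = 1 := by omega
  refine ⟨i, hfi, fun j hj => ?_⟩
  have hrest : ∑ x ∈ Finset.univ.erase i, f x = 0 := by omega
  exact Finset.sum_eq_zero_iff.mp hrest j (Finset.mem_erase.mpr ⟨hj, Finset.mem_univ j⟩)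

/-- An exponent matrix with unit row and column sums is a permutation pattern. [folklore] -/
private theorem exists_perm_eq_permExp {e : (Fin n × Fin n) →₀ ℕ} (hr : ∀ a, rowSum e a = 1)
    (hc : ∀ b, colSum e b = 1) : ∃ π : Equiv.Perm (Fin n), e = permExp π := by
  classical
  have hex : ∀ b : Fin n, ∃ a, e (a, b) = 1 ∧ ∀ a', a' ≠ a → e (a', b) = 0 :=
    fun b => exists_eq_one_of_sum_eq_one (fun a => e (a, b)) (hc b)
  choose g hg1 hg0 using hex
  have hinj : Function.Injective g := by
    intro b b' hbb'
    by_contra hne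
    have h2 : ∑ x ∈ ({b, b'} : Finset (Fin n)), e (g b, x) ≤ rowSum e (g b) :=
      Finset.sum_le_sum_of_subset_of_nonneg (Finset.subset_univ _) fun _ _ _ => Nat.zero_le _
    rw [Finset.sum_pair hne] at h2
    rw [hg1 b, hbb', hg1 b', ← hbb', hr] at h2
    omega
  refine ⟨Equiv.ofBijective g (Finite.injective_iff_bijective.mp hinj), ?_⟩
  ext ⟨a, b⟩
  rw [permExp_apply]
  simp only [Equiv.ofBijective_apply]
  split_ifs with h
  · rw [← h]; exact hg1 b
  · exact hg0 b a (Ne.symm h)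

/-- Every monomial of a form of degree `n` fixed by the row/column scalings is a permutation monomial. [folklore] -/
private theorem exists_perm_of_mem_support [CharZero k] {p : MvPolynomial (Fin n × Fin n) k}
    (hp : p.IsHomogeneous n)
    (hfix : ∀ a b : Fin n, linSubst _ k (Matrix.diagonal (rcWeight a b)) p = p)
    {e : (Fin n × Fin n) →₀ ℕ} (he : e ∈ p.support) : ∃ π : Equiv.Perm (Fin n), e = permExp π :=
  exists_perm_eq_permExp (rowSum_eq_one hp hfix he) (colSum_eq_one hp hfix he)

/-- A form supported on permutation patterns is the sum of its permutation monomials. [folklore] -/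
private theorem eq_sum_monomial_permExp {p : MvPolynomial (Fin n × Fin n) k}
    (hsupp : ∀ e ∈ p.support, ∃ π : Equiv.Perm (Fin n), e = permExp π) :
    p = ∑ π : Equiv.Perm (Fin n), monomial (permExp π) (coeff (permExp π) p) := by
  classical
  refine MvPolynomial.ext _ _ fun e => ?_
  rw [coeff_sum]
  simp only [coeff_monomial]
  by_cases he : ∃ π : Equiv.Perm (Fin n), e = permExp π
  · obtain ⟨π, rfl⟩ := he
    rw [Finset.sum_eq_single π]
    · rw [if_pos rfl]
    · intro π' _ hne
      rw [if_neg (fun h => hne (permExp_injective h))]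
    · intro h; exact absurd (Finset.mem_univ π) h
  · rw [Finset.sum_eq_zero (fun π _ => if_neg (fun h => he ⟨π, h.symm⟩))]
    by_contra hne
    exact he (hsupp e (mem_support_iff.mpr hne))


/-! ### Row permutations of the variables -/

/-- Row permutation of the variable indices: `(a, b) ↦ (τ a, b)`. [folklore] -/
private def rowPerm (τ : Equiv.Perm (Fin n)) : Equiv.Perm (Fin n × Fin n) :=
  Equiv.prodCongr τ (Equiv.refl _)

/-- Value of the row permutation of indices. [folklore] -/
@[simp] private theorem rowPerm_apply (τ : Equiv.Perm (Fin n)) (x : Fin n × Fin n) :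
    rowPerm τ x = (τ x.1, x.2) := rfl

/-- Row permutation of a permutation pattern: `permExp π ↦ permExp (τ π)`. [folklore] -/
private theorem mapDomain_rowPerm_permExp (τ π : Equiv.Perm (Fin n)) :
    Finsupp.mapDomain (rowPerm τ) (permExp π) = permExp (τ * π) := by
  unfold permExp
  rw [Finsupp.mapDomain_finsetSum]
  simp only [Finsupp.mapDomain_single, rowPerm_apply, Equiv.Perm.mul_apply]

/-- Row permutation of a permutation monomial. [folklore] -/
private theorem rename_rowPerm_monomial_permExp (τ π : Equiv.Perm (Fin n)) (c : k) :
    rename (rowPerm τ) (monomial (permExp π) c) = monomial (permExp (τ * π)) c := by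
  rw [rename_monomial, mapDomain_rowPerm_permExp]

/-- Row permutations fix the permanent. [folklore] -/
private theorem rename_rowPerm_perPoly (τ : Equiv.Perm (Fin n)) :
    rename (rowPerm τ) (perPoly (Fin n) k) = perPoly (Fin n) k := by
  rw [perPoly_eq_sum, map_sum]
  simp_rw [rename_rowPerm_monomial_permExp]
  exact Fintype.sum_equiv (Equiv.mulLeft τ) _ _ fun π => rfl

/-- Coefficients of permutation monomials after a row permutation. [folklore] -/
private theorem coeff_permExp_rename_rowPerm (τ π : Equiv.Perm (Fin n)) (p : MvPolynomial (Fin n × Fin n) k) :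
    coeff (permExp (τ * π)) (rename (rowPerm τ) p) = coeff (permExp π) p := by
  rw [← mapDomain_rowPerm_permExp]
  exact coeff_rename_mapDomain _ (rowPerm τ).injective _ _

/-- The generic determinant as a sum of monomials with signed coefficients. [folklore] -/
private theorem detPoly_eq_sum' (n : ℕ) :
    detPoly (Fin n) k = ∑ π : Equiv.Perm (Fin n),
      monomial (permExp π) ((Equiv.Perm.sign π : ℤ) : k) := by
  rw [detPoly_eq_sum]
  refine Finset.sum_congr rfl fun π _ => ?_
  rw [smul_monomial, smul_eq_mul, mul_one]

/-- The weight negating the variables of row class `a₀`. [folklore] -/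
private def negRowWeight (a₀ : Fin n) (x : Fin n × Fin n) : k := if x.1 = a₀ then -1 else 1

/-- The row-negating weights are nonzero. [folklore] -/
private theorem negRowWeight_ne_zero (a₀ : Fin n) (x : Fin n × Fin n) : negRowWeight (k := k) a₀ x ≠ 0 := by
  unfold negRowWeight; split_ifs <;> simp

/-- The row negation multiplies every permutation monomial by `-1`. [folklore] -/
private theorem prod_negRowWeight_permExp (a₀ : Fin n) (π : Equiv.Perm (Fin n)) :
    ∏ i, negRowWeight (k := k) a₀ (π i, i) = -1 := by
  simp only [negRowWeight]
  simp_rw [show ∀ i, (π i = a₀ ↔ i = π.symm a₀) from fun i => π.apply_eq_iff_eq_symm_apply (y := a₀)]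
  rw [Finset.prod_ite_eq']
  simp

/-- `sgn(τπ) = -sgn(π)` for a transposition `τ`, cast to the field. [folklore] -/
private theorem cast_sign_swap_mul {a₀ a₁ : Fin n} (hne : a₀ ≠ a₁) (π : Equiv.Perm (Fin n)) :
    ((Equiv.Perm.sign (Equiv.swap a₀ a₁ * π) : ℤ) : k) = -((Equiv.Perm.sign π : ℤ) : k) := by
  rw [Equiv.Perm.sign_mul, Equiv.Perm.sign_swap hne, Units.val_mul, Units.val_neg, Units.val_one]
  push_cast
  ring

/-- A row transposition composed with a row negation fixes the determinant. [folklore] -/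
private theorem linSubst_negRow_rename_swap_detPoly {a₀ a₁ : Fin n} (hne : a₀ ≠ a₁) :
    linSubst _ k (Matrix.diagonal (negRowWeight a₀))
        (rename (rowPerm (Equiv.swap a₀ a₁)) (detPoly (Fin n) k)) = detPoly (Fin n) k := by
  rw [detPoly_eq_sum', map_sum, map_sum]
  simp_rw [rename_rowPerm_monomial_permExp, linSubst_diagonal_monomial', prod_pow_permExp,
    prod_negRowWeight_permExp, smul_monomial, smul_eq_mul]
  refine Fintype.sum_equiv (Equiv.mulLeft (Equiv.swap a₀ a₁)) _ _ fun π => ?_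
  simp only [Equiv.coe_mulLeft]
  rw [cast_sign_swap_mul hne, neg_one_mul]

/-- Fixedness under a signed row transposition forces `c_{τπ} = -c_π`. [folklore] -/
private theorem coeff_permExp_swap_mul {a₀ a₁ : Fin n} (π : Equiv.Perm (Fin n))
    {p : MvPolynomial (Fin n × Fin n) k}
    (hfix : linSubst _ k (Matrix.diagonal (negRowWeight a₀))
        (rename (rowPerm (Equiv.swap a₀ a₁)) p) = p) :
    coeff (permExp (Equiv.swap a₀ a₁ * π)) p = -coeff (permExp π) p := by
  have h := congrArg (coeff (permExp (Equiv.swap a₀ a₁ * π))) hfix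
  rw [coeff_linSubst_diagonal, prod_pow_permExp, prod_negRowWeight_permExp,
    coeff_permExp_rename_rowPerm] at h
  rw [← h, neg_one_mul]

/-! ### The two characterizations -/

/-- **The permanent is characterized by its stabilizer — proof** (Mulmuley–Sohoni 2008, Thm. 2.3
"cf. Part I"; GCT Introduction, Lecture 13, Prop. [GCT1](2)), over any field of characteristic
zero: a form of degree `n` in the `n²` matrix variables fixed by every `γ ∈ GL_{n²}` that fixes
`per_n` is a scalar multiple of `per_n`. Proof (elementary, not MS's): invariance under the
diagonal substitutions `X_{ab} ↦ 2^{[a=a₀]} 2^{-[b=b₀]} X_{ab}` (which fix `per_n`) forces every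
monomial in the support to have all row and column sums of its exponent matrix equal, hence equal
to `1` — a permutation pattern; invariance under row permutations `X_{ab} ↦ X_{τa,b}` (which fix
`per_n`) forces all coefficients to agree.
[cite: MulmuleySohoniGCT2SIAM2008, Thm. 2.3 (arXiv cs/0612134 Thm. 3.3)]
[cite: MulmuleySohoniGCTIntro2007, Lecture 13, Prop. [GCT1](2)] -/
theorem perPoly_eq_smul_of_fixed [CharZero k] (p : MvPolynomial (Fin n × Fin n) k)
    (hp : p.IsHomogeneous n)
    (hfix : ∀ γ : GL (Fin n × Fin n) k,
      linSubstRep _ k γ (perPoly (Fin n) k) = perPoly (Fin n) k → linSubstRep _ k γ p = p) :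
    ∃ c : k, p = c • perPoly (Fin n) k := by
  have hdiag : ∀ a b : Fin n, linSubst _ k (Matrix.diagonal (rcWeight a b)) p = p := fun a b => by
    have h := hfix (diagGL (rcWeight a b) (rcWeight_ne_zero a b))
      (by rw [linSubstRep_diagGL, linSubst_rcDiag_perPoly])
    rwa [linSubstRep_diagGL] at h
  have hsupp : ∀ e ∈ p.support, ∃ π : Equiv.Perm (Fin n), e = permExp π :=
    fun e he => exists_perm_of_mem_support hp hdiag he
  have hcoeff : ∀ π : Equiv.Perm (Fin n), coeff (permExp π) p = coeff (permExp 1) p := fun π => by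
    have h := hfix (permGL (rowPerm π)) (by rw [linSubstRep_permGL, rename_rowPerm_perPoly])
    rw [linSubstRep_permGL] at h
    have h2 := coeff_permExp_rename_rowPerm π 1 p
    rw [mul_one, h] at h2
    exact h2
  refine ⟨coeff (permExp 1) p, ?_⟩
  conv_lhs => rw [eq_sum_monomial_permExp hsupp]
  rw [perPoly_eq_sum, Finset.smul_sum]
  refine Finset.sum_congr rfl fun π _ => ?_
  rw [hcoeff π, smul_monomial, smul_eq_mul, mul_one]

/-- **The determinant is characterized by its stabilizer — proof** (Mulmuley–Sohoni 2008,
Thm. 2.3 "cf. Part I"; GCT Introduction, Lecture 13, Prop. [GCT1](1)), over any field of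
characteristic zero: a form of degree `n` in the `n²` matrix variables fixed by every
`γ ∈ GL_{n²}` that fixes `det_n` is a scalar multiple of `det_n`. Proof as for the permanent
(the same diagonal substitutions fix `det_n`), the permutation step using the substitutions
`X_{ab} ↦ (-1)^{[a=a₀]} X_{swap(a₀,a₁) a, b}` (a row transposition composed with a sign change,
which fix `det_n`): they force `c_{τπ} = -c_π`, whence `c_π = sgn(π) c_1` by induction on
transpositions. [cite: MulmuleySohoniGCT2SIAM2008, Thm. 2.3 (arXiv cs/0612134 Thm. 3.3)]
[cite: MulmuleySohoniGCTIntro2007, Lecture 13, Prop. [GCT1](1)] -/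
theorem detPoly_eq_smul_of_fixed [CharZero k] (p : MvPolynomial (Fin n × Fin n) k)
    (hp : p.IsHomogeneous n)
    (hfix : ∀ γ : GL (Fin n × Fin n) k,
      linSubstRep _ k γ (detPoly (Fin n) k) = detPoly (Fin n) k → linSubstRep _ k γ p = p) :
    ∃ c : k, p = c • detPoly (Fin n) k := by
  have hdiag : ∀ a b : Fin n, linSubst _ k (Matrix.diagonal (rcWeight a b)) p = p := fun a b => by
    have h := hfix (diagGL (rcWeight a b) (rcWeight_ne_zero a b))
      (by rw [linSubstRep_diagGL, linSubst_rcDiag_detPoly])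
    rwa [linSubstRep_diagGL] at h
  have hsupp : ∀ e ∈ p.support, ∃ π : Equiv.Perm (Fin n), e = permExp π :=
    fun e he => exists_perm_of_mem_support hp hdiag he
  have hswap : ∀ a₀ a₁ : Fin n, a₀ ≠ a₁ → ∀ π : Equiv.Perm (Fin n),
      coeff (permExp (Equiv.swap a₀ a₁ * π)) p = -coeff (permExp π) p := by
    intro a₀ a₁ hne π
    refine coeff_permExp_swap_mul π ?_
    have h := hfix (diagGL (negRowWeight a₀) (negRowWeight_ne_zero a₀) *
        permGL (rowPerm (Equiv.swap a₀ a₁)))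
      (by rw [map_mul, Module.End.mul_apply, linSubstRep_permGL, linSubstRep_diagGL,
            linSubst_negRow_rename_swap_detPoly hne])
    rwa [map_mul, Module.End.mul_apply, linSubstRep_permGL, linSubstRep_diagGL] at h
  have hsign : ∀ π : Equiv.Perm (Fin n),
      coeff (permExp π) p = ((Equiv.Perm.sign π : ℤ) : k) * coeff (permExp 1) p := by
    intro π
    induction π using Equiv.Perm.swap_induction_on with
    | one => simp
    | swap_mul f x y hxy ih => rw [hswap x y hxy f, ih, cast_sign_swap_mul hxy, neg_mul]
  refine ⟨coeff (permExp 1) p, ?_⟩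
  conv_lhs => rw [eq_sum_monomial_permExp hsupp]
  rw [detPoly_eq_sum', Finset.smul_sum]
  refine Finset.sum_congr rfl fun π _ => ?_
  rw [hsign π, smul_monomial, smul_eq_mul, mul_comm]


end CharacterizedByStabilizer

/-- Discharge of `perPoly_isCharacterizedByStabilizer` (Mulmuley–Sohoni 2008, Thm. 2.3;
GCT Introduction, Lecture 13, Prop. [GCT1](2)).
[cite: MulmuleySohoniGCT2SIAM2008, Thm. 2.3 (arXiv cs/0612134 Thm. 3.3)] -/
theorem perPoly_isCharacterizedByStabilizer_holds : perPoly_isCharacterizedByStabilizer :=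
  fun _ p hp hfix => CharacterizedByStabilizer.perPoly_eq_smul_of_fixed p hp
    fun γ hγ => hfix γ (Subgroup.mem_top γ) hγ

/-- Discharge of `detPoly_isCharacterizedByStabilizer` (Mulmuley–Sohoni 2008, Thm. 2.3;
GCT Introduction, Lecture 13, Prop. [GCT1](1)).
[cite: MulmuleySohoniGCT2SIAM2008, Thm. 2.3 (arXiv cs/0612134 Thm. 3.3)] -/
theorem detPoly_isCharacterizedByStabilizer_holds : detPoly_isCharacterizedByStabilizer :=
  fun _ p hp hfix => CharacterizedByStabilizer.detPoly_eq_smul_of_fixed p hp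
    fun γ hγ => hfix γ (Subgroup.mem_top γ) hγ

/-- With the facts discharged: the fixed forms of the stabilizer of `det_m` are exactly the line
`ℂ · det_m`, unconditionally. [cite: MulmuleySohoniGCT2SIAM2008, Thm. 2.3 (arXiv cs/0612134 Thm. 3.3)] -/
theorem fixedForms_detPoly_eq (m : ℕ) :
    fixedForms ⊤ (detPoly (Fin m) ℂ) m = ℂ ∙ detPoly (Fin m) ℂ :=
  detPoly_isCharacterizedByStabilizer_holds.fixedForms_eq m

/-- With the facts discharged: the fixed forms of the stabilizer of `per_n` are exactly the line
`ℂ · per_n`, unconditionally. [cite: MulmuleySohoniGCT2SIAM2008, Thm. 2.3 (arXiv cs/0612134 Thm. 3.3)] -/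
theorem fixedForms_perPoly_eq (n : ℕ) :
    fixedForms ⊤ (perPoly (Fin n) ℂ) n = ℂ ∙ perPoly (Fin n) ℂ :=
  perPoly_isCharacterizedByStabilizer_holds.fixedForms_eq n

end Literature.Computability.AlgebraicComplexity

namespace Literature.Computability.AlgebraicComplexity

/-! ## Clause (3): the padded permanent is characterized by its stabilizer

Mulmuley–Sohoni, *GCT: Introduction*, Lecture 13, Prop. [GCT1] `[tex:0709.0746 Lecture13.tex
L141–152]`: "3. Finally, `f = φ(h) ∈ P(V)` is also characterized by its stabilizer", where
`φ(h) = y^{m-n} perm(X)` `[Lecture12.tex L44–96]` ("think of `X` as a submatrix of `Y`, say the lower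
principal submatrix. Fix a variable entry `y` of `Y` outside of `X` … `φ` takes `w(x) ∈ W` to
`y^{m-n} w(x) ∈ V`"), `G = GL_ℓ(ℂ)` acting on `V = Sym^m(Y)`; GCT II, SIAM J. Comput. 38 (2008)
Thm. 2.3 (arXiv Thm. 3.3 `[tex:cs_0612134 main.tex L803–822]`) lists `f = φ(h)` as "almost
excellent" (characterization by the stabilizer being part of "excellent"). In the tree's conventions
(`paddedPerPoly k n m` = `X₀₀ ^ (m - n) · per_n`, `per_n` on the bottom-right `n × n` block,
`OrbitClosure.lean`) and the `GL`-reading of this file: for `n < m`, every form of degree `m` in the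
`m²` variables fixed by every `γ ∈ GL_{m²}` that fixes `X₀₀^{m-n} per_n` is a scalar multiple of it.
PROVED below (`CharacterizedByStabilizer.paddedPerPoly_eq_smul_of_fixed`, any field of
characteristic zero; `paddedPerPoly_isCharacterizedByStabilizer` over `ℂ`), by the torus-weight /
row-permutation argument of the two proofs above plus two more one-parameter subgroups of the
stabilizer: scaling a variable outside `{X₀₀} ∪ block` (kills it from the support) and scaling
`X₀₀ ↦ 2 X₀₀` together with one block row `↦ 2^{-(m-n)} ·` (pins the exponent of `X₀₀` to `m - n`).
No new named fact (D-0026). The case `n = m` is clause (2) up to renaming and is not restated. -/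

namespace CharacterizedByStabilizer

section Padded

variable {k : Type*} [Field k] {n m : ℕ} [NeZero m]

/-! ### The padded permanent as a sum of monomials -/

/-- Exponent of the padded permutation monomial `X₀₀^{m-n} ∏_{b ∈ B} X_{π b, b}`, `B` the
bottom-right block. [folklore] -/
private def padExp (π : Equiv.Perm (BlockIdx n m)) : (Fin m × Fin m) →₀ ℕ :=
  Finsupp.single ((0 : Fin m), (0 : Fin m)) (m - n) +
    ∑ b : BlockIdx n m, Finsupp.single (((π b : BlockIdx n m) : Fin m), ((b : BlockIdx n m) : Fin m)) 1

omit [NeZero m] in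
/-- Value of the block part of `padExp` at a variable index. [folklore] -/
private theorem sum_single_block_apply (π : Equiv.Perm (BlockIdx n m)) (x : Fin m × Fin m) :
    (∑ b : BlockIdx n m,
        Finsupp.single (((π b : BlockIdx n m) : Fin m), ((b : BlockIdx n m) : Fin m)) 1) x =
      if h : m - n ≤ (x.2 : ℕ) then (if ((π ⟨x.2, h⟩ : BlockIdx n m) : Fin m) = x.1 then 1 else 0)
      else 0 := by
  rw [Finsupp.finsetSum_apply]
  simp only [Finsupp.single_apply]
  rcases x with ⟨i, j⟩
  by_cases h : m - n ≤ (j : ℕ)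
  · rw [dif_pos h, Finset.sum_eq_single (⟨j, h⟩ : BlockIdx n m)]
    · simp only [Prod.mk.injEq, and_true]
    · intro b _ hb
      rw [if_neg]
      simp only [Prod.mk.injEq, not_and]
      intro _ hbj
      exact hb (Subtype.ext hbj)
    · intro hh; exact absurd (Finset.mem_univ _) hh
  · rw [dif_neg h]
    refine Finset.sum_eq_zero fun b _ => if_neg ?_
    simp only [Prod.mk.injEq, not_and]
    intro _ hbj
    exact h (hbj ▸ b.2)

/-- Value of `padExp` at a variable index. [folklore] -/
private theorem padExp_apply (π : Equiv.Perm (BlockIdx n m)) (x : Fin m × Fin m) :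
    padExp π x = (if x = ((0 : Fin m), (0 : Fin m)) then m - n else 0) +
      (if h : m - n ≤ (x.2 : ℕ) then (if ((π ⟨x.2, h⟩ : BlockIdx n m) : Fin m) = x.1 then 1 else 0)
      else 0) := by
  unfold padExp
  rw [Finsupp.add_apply, sum_single_block_apply, Finsupp.single_apply]
  by_cases hx : x = ((0 : Fin m), (0 : Fin m))
  · rw [if_pos hx, if_pos hx.symm]
  · rw [if_neg hx, if_neg (Ne.symm hx)]

/-- `padExp π` vanishes at every variable outside `{X₀₀} ∪ block × block`. [folklore] -/
private theorem padExp_apply_of_not_mem (π : Equiv.Perm (BlockIdx n m)) {x : Fin m × Fin m}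
    (hx0 : x ≠ ((0 : Fin m), (0 : Fin m))) (hx : ¬(m - n ≤ (x.1 : ℕ) ∧ m - n ≤ (x.2 : ℕ))) :
    padExp π x = 0 := by
  rw [padExp_apply, if_neg hx0, zero_add]
  by_cases h : m - n ≤ (x.2 : ℕ)
  · rw [dif_pos h, if_neg]
    intro h1
    exact hx ⟨h1 ▸ (π ⟨x.2, h⟩).2, h⟩
  · rw [dif_neg h]

/-- Block indices are nonzero when `n < m`. [folklore] -/
private theorem coe_ne_zero_of_lt (hnm : n < m) (a : BlockIdx n m) : ((a : Fin m) : Fin m) ≠ 0 := by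
  intro h
  have := a.2
  rw [h, Fin.val_zero] at this
  omega

/-- A block variable is not the padding variable `X₀₀` (for `n < m`). [folklore] -/
private theorem blockVar_ne_zero (hnm : n < m) (a b : BlockIdx n m) :
    ((((a : BlockIdx n m) : Fin m), ((b : BlockIdx n m) : Fin m)) : Fin m × Fin m) ≠
      ((0 : Fin m), (0 : Fin m)) :=
  fun h => coe_ne_zero_of_lt hnm a (Prod.mk.inj h).1

/-- Distinct block permutations have distinct padded monomials. [folklore] -/
private theorem padExp_injective (hnm : n < m) : Function.Injective (padExp (n := n) (m := m)) := by
  intro π π' h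
  refine Equiv.ext fun b => Subtype.ext ?_
  have key := congrArg (fun e => e (((π b : BlockIdx n m) : Fin m), ((b : BlockIdx n m) : Fin m))) h
  rw [padExp_apply, padExp_apply, if_neg (blockVar_ne_zero hnm (π b) b), zero_add, zero_add,
    dif_pos b.2, dif_pos b.2] at key
  simp only [Subtype.coe_eta, if_true] at key
  by_contra hne
  rw [if_neg (fun h' => hne h'.symm)] at key
  exact one_ne_zero key

/-- A product of variables is the monomial of the sum of the unit exponents. [folklore] -/
private theorem prod_X_eq_monomial_sum_single {σ ι : Type*} [Fintype ι] (g : ι → σ) :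
    (∏ i, X (g i) : MvPolynomial σ k) = monomial (∑ i, Finsupp.single (g i) 1) 1 := by
  rw [monomial_sum_one]
  rfl

/-- The padded permanent as a sum of padded permutation monomials (Leibniz expansion of the
block permanent times `X₀₀^{m-n}`). [folklore] -/
private theorem paddedPerPoly_eq_sum :
    paddedPerPoly k n m = ∑ π : Equiv.Perm (BlockIdx n m), monomial (padExp π) 1 := by
  unfold paddedPerPoly perPoly Matrix.permanent
  rw [map_sum, Finset.mul_sum]
  refine Finset.sum_congr rfl fun π _ => ?_
  rw [map_prod]
  simp only [Matrix.mvPolynomialX_apply, rename_X]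
  rw [prod_X_eq_monomial_sum_single, X_pow_eq_monomial, monomial_mul, one_mul]
  rfl

/-! ### Characters of diagonal substitutions on the padded monomials -/

section Characters

variable {σ : Type*} [Fintype σ] [DecidableEq σ]

omit [DecidableEq σ] in
/-- Characters are multiplicative in the exponent. [folklore] -/
private theorem prod_pow_add' (β : σ → k) (f g : σ →₀ ℕ) :
    ∏ x, β x ^ ((f + g) x) = (∏ x, β x ^ f x) * ∏ x, β x ^ g x := by
  simp only [Finsupp.add_apply, pow_add, Finset.prod_mul_distrib]

/-- The character of a diagonal substitution on `X_y^c`. [folklore] -/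
private theorem prod_pow_single (β : σ → k) (y : σ) (c : ℕ) :
    ∏ x, β x ^ (Finsupp.single y c x) = β y ^ c := by
  simp only [Finsupp.single_apply, pow_ite, pow_zero]
  rw [Finset.prod_ite_eq]
  simp

/-- The character of a diagonal substitution on a product of distinct-or-not variables. [folklore] -/
private theorem prod_pow_sum_single {ι : Type*} [Fintype ι] (β : σ → k) (g : ι → σ) :
    ∏ x, β x ^ ((∑ i, Finsupp.single (g i) 1) x) = ∏ i, β (g i) := by
  simp only [Finsupp.finsetSum_apply, ← Finset.prod_pow_eq_pow_sum]
  rw [Finset.prod_comm]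
  refine Finset.prod_congr rfl fun i _ => ?_
  rw [prod_pow_single, pow_one]

end Characters

/-- The character of a diagonal substitution on a padded permutation monomial. [folklore] -/
private theorem prod_pow_padExp (β : Fin m × Fin m → k) (π : Equiv.Perm (BlockIdx n m)) :
    ∏ x, β x ^ padExp π x =
      β ((0 : Fin m), (0 : Fin m)) ^ (m - n) *
        ∏ b : BlockIdx n m, β (((π b : BlockIdx n m) : Fin m), ((b : BlockIdx n m) : Fin m)) := by
  unfold padExp
  rw [prod_pow_add', prod_pow_single, prod_pow_sum_single]

/-! ### Step 1: variables outside `{X₀₀} ∪ block` do not occur -/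

/-- The weight scaling the single variable `z` by `2`. [folklore] -/
private def zWeight (z x : Fin m × Fin m) : k := if x = z then 2 else 1

omit [NeZero m] in
/-- The `z`-scaling weights are nonzero in characteristic zero. [folklore] -/
private theorem zWeight_ne_zero [CharZero k] (z x : Fin m × Fin m) : zWeight (k := k) z x ≠ 0 := by
  unfold zWeight; split_ifs <;> simp

omit [NeZero m] in
/-- The character of the `z`-scaling on `X^e` is `2^{e z}`. [folklore] -/
private theorem prod_zWeight_pow (z : Fin m × Fin m) (e : (Fin m × Fin m) →₀ ℕ) :
    ∏ x, zWeight (k := k) z x ^ e x = 2 ^ e z := by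
  simp only [zWeight, ite_pow, one_pow]
  rw [Finset.prod_ite_eq']
  simp

/-- The `z`-scaling fixes the padded permanent when `z` is outside `{X₀₀} ∪ block × block`. [folklore] -/
private theorem linSubst_zWeight_paddedPerPoly {z : Fin m × Fin m}
    (hz0 : z ≠ ((0 : Fin m), (0 : Fin m))) (hz : ¬(m - n ≤ (z.1 : ℕ) ∧ m - n ≤ (z.2 : ℕ))) :
    linSubst _ k (Matrix.diagonal (zWeight z)) (paddedPerPoly k n m) = paddedPerPoly k n m := by
  rw [paddedPerPoly_eq_sum, map_sum]
  refine Finset.sum_congr rfl fun π _ => ?_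
  rw [linSubst_diagonal_monomial', prod_zWeight_pow, padExp_apply_of_not_mem π hz0 hz, pow_zero,
    one_smul]

omit [NeZero m] in
/-- Fixedness under the `z`-scaling kills `z` from the support. [folklore] -/
private theorem apply_eq_zero_of_fixed [CharZero k] {p : MvPolynomial (Fin m × Fin m) k}
    {z : Fin m × Fin m} (hfix : linSubst _ k (Matrix.diagonal (zWeight z)) p = p)
    {e : (Fin m × Fin m) →₀ ℕ} (he : e ∈ p.support) : e z = 0 := by
  have h := prod_pow_eq_one_of_fixed hfix he
  rw [prod_zWeight_pow] at h
  have h' : ((2 ^ e z : ℕ) : k) = ((2 ^ 0 : ℕ) : k) := by rw [pow_zero]; push_cast; exact h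
  exact Nat.pow_right_injective le_rfl (Nat.cast_injective h')

/-! ### Step 2: block row/column scalings -/

/-- The block row/column scalings fix the padded monomials (`n < m`). [folklore] -/
private theorem prod_rcWeight_padExp [CharZero k] (hnm : n < m) (a b : BlockIdx n m)
    (π : Equiv.Perm (BlockIdx n m)) :
    ∏ x, rcWeight (k := k) (a : Fin m) (b : Fin m) x ^ padExp π x = 1 := by
  rw [prod_pow_padExp]
  have h0 : rcWeight (k := k) (a : Fin m) (b : Fin m) ((0 : Fin m), (0 : Fin m)) = 1 := by
    unfold rcWeight
    rw [if_neg (coe_ne_zero_of_lt hnm a).symm, if_neg (coe_ne_zero_of_lt hnm b).symm, mul_one]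
  rw [h0, one_pow, one_mul]
  simp only [rcWeight, Finset.prod_mul_distrib]
  have h1 : ∏ c : BlockIdx n m, (if (((π c : BlockIdx n m) : Fin m)) = (a : Fin m) then (2 : k) else 1)
      = 2 := by
    simp_rw [show ∀ c : BlockIdx n m, ((((π c : BlockIdx n m) : Fin m)) = (a : Fin m) ↔ c = π.symm a)
      from fun c => by rw [Subtype.coe_inj, π.apply_eq_iff_eq_symm_apply]]
    rw [Finset.prod_ite_eq']; simp
  have h2 : ∏ c : BlockIdx n m, (if ((c : BlockIdx n m) : Fin m) = (b : Fin m) then (2⁻¹ : k) else 1)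
      = 2⁻¹ := by
    simp_rw [show ∀ c : BlockIdx n m, (((c : BlockIdx n m) : Fin m) = (b : Fin m) ↔ c = b)
      from fun c => Subtype.coe_inj]
    rw [Finset.prod_ite_eq']; simp
  rw [h1, h2]
  exact mul_inv_cancel₀ two_ne_zero

/-- The block row/column scalings fix the padded permanent (`n < m`). [folklore] -/
private theorem linSubst_rcDiag_paddedPerPoly [CharZero k] (hnm : n < m) (a b : BlockIdx n m) :
    linSubst _ k (Matrix.diagonal (rcWeight (a : Fin m) (b : Fin m))) (paddedPerPoly k n m) =
      paddedPerPoly k n m := by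
  rw [paddedPerPoly_eq_sum, map_sum]
  refine Finset.sum_congr rfl fun π _ => ?_
  rw [linSubst_diagonal_monomial', prod_rcWeight_padExp hnm, one_smul]

/-! ### Step 3: the padding variable against one block row -/

/-- The weight `X₀₀ ↦ 2 X₀₀`, row `a₀` of the grid `↦ (2^{m-n})⁻¹ ·`. [folklore] -/
private def yWeight (a₀ : Fin m) (x : Fin m × Fin m) : k :=
  (if x = ((0 : Fin m), (0 : Fin m)) then 2 else 1) * (if x.1 = a₀ then (2 ^ (m - n))⁻¹ else 1)

/-- The `y`-weights are nonzero in characteristic zero. [folklore] -/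
private theorem yWeight_ne_zero [CharZero k] (a₀ : Fin m) (x : Fin m × Fin m) :
    yWeight (k := k) (n := n) a₀ x ≠ 0 := by
  unfold yWeight
  refine mul_ne_zero ?_ ?_ <;> split_ifs <;> simp

/-- The character of the `y`-weight on `X^e` (row `a₀ ≠ 0`). [folklore] -/
private theorem prod_yWeight_pow (a₀ : Fin m) (e : (Fin m × Fin m) →₀ ℕ) :
    ∏ x, yWeight (k := k) (n := n) a₀ x ^ e x =
      2 ^ e ((0 : Fin m), (0 : Fin m)) * ((2 ^ (m - n))⁻¹) ^ rowSum e a₀ := by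
  simp only [yWeight, mul_pow, Finset.prod_mul_distrib, ite_pow, one_pow]
  congr 1
  · rw [Finset.prod_ite_eq']; simp
  · rw [Fintype.prod_prod_type]
    have h : ∀ x : Fin m, (∏ y : Fin m, if x = a₀ then ((2 : k) ^ (m - n))⁻¹ ^ e (x, y) else 1) =
        if x = a₀ then ((2 : k) ^ (m - n))⁻¹ ^ rowSum e x else 1 := fun x => by
      split_ifs <;> simp [rowSum, Finset.prod_pow_eq_pow_sum]
    simp_rw [h]
    rw [Finset.prod_ite_eq']
    simp

/-- The `y`-weight fixes the padded monomials (`n < m`, `a₀` a block row). [folklore] -/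
private theorem prod_yWeight_padExp [CharZero k] (hnm : n < m) (a₀ : BlockIdx n m)
    (π : Equiv.Perm (BlockIdx n m)) :
    ∏ x, yWeight (k := k) (n := n) (a₀ : Fin m) x ^ padExp π x = 1 := by
  rw [prod_pow_padExp]
  have h0 : yWeight (k := k) (n := n) (a₀ : Fin m) ((0 : Fin m), (0 : Fin m)) = 2 := by
    unfold yWeight
    rw [if_pos rfl, if_neg (coe_ne_zero_of_lt hnm a₀).symm, mul_one]
  rw [h0]
  simp only [yWeight, Finset.prod_mul_distrib]
  have h1 : ∏ c : BlockIdx n m,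
      (if ((((π c : BlockIdx n m) : Fin m), ((c : BlockIdx n m) : Fin m)) : Fin m × Fin m) =
          ((0 : Fin m), (0 : Fin m)) then (2 : k) else 1) = 1 :=
    Finset.prod_eq_one fun c _ => if_neg (blockVar_ne_zero hnm (π c) c)
  have h2 : ∏ c : BlockIdx n m,
      (if (((π c : BlockIdx n m) : Fin m)) = (a₀ : Fin m) then ((2 : k) ^ (m - n))⁻¹ else 1) =
        ((2 : k) ^ (m - n))⁻¹ := by
    simp_rw [show ∀ c : BlockIdx n m, ((((π c : BlockIdx n m) : Fin m)) = (a₀ : Fin m) ↔ c = π.symm a₀)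
      from fun c => by rw [Subtype.coe_inj, π.apply_eq_iff_eq_symm_apply]]
    rw [Finset.prod_ite_eq']; simp
  rw [h1, h2, one_mul]
  exact mul_inv_cancel₀ (pow_ne_zero _ two_ne_zero)

/-- The `y`-weight fixes the padded permanent (`n < m`, `a₀` a block row). [folklore] -/
private theorem linSubst_yDiag_paddedPerPoly [CharZero k] (hnm : n < m) (a₀ : BlockIdx n m) :
    linSubst _ k (Matrix.diagonal (yWeight (n := n) (a₀ : Fin m))) (paddedPerPoly k n m) =
      paddedPerPoly k n m := by
  rw [paddedPerPoly_eq_sum, map_sum]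
  refine Finset.sum_congr rfl fun π _ => ?_
  rw [linSubst_diagonal_monomial', prod_yWeight_padExp hnm, one_smul]

/-- Fixedness under the `y`-weight pins the exponent of `X₀₀` to `(m - n) ·` the row sum of the
scaled block row. [folklore] -/
private theorem apply_zero_eq_of_fixed [CharZero k] {p : MvPolynomial (Fin m × Fin m) k}
    (a₀ : BlockIdx n m)
    (hfix : linSubst _ k (Matrix.diagonal (yWeight (n := n) (a₀ : Fin m))) p = p)
    {e : (Fin m × Fin m) →₀ ℕ} (he : e ∈ p.support) :
    e ((0 : Fin m), (0 : Fin m)) = (m - n) * rowSum e (a₀ : Fin m) := by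
  have h := prod_pow_eq_one_of_fixed hfix he
  rw [prod_yWeight_pow, inv_pow, ← pow_mul,
    mul_inv_eq_one₀ (pow_ne_zero _ two_ne_zero)] at h
  have h' : ((2 ^ e ((0 : Fin m), (0 : Fin m)) : ℕ) : k) = ((2 ^ ((m - n) * rowSum e (a₀ : Fin m)) : ℕ) : k) := by
    push_cast; exact h
  exact Nat.pow_right_injective le_rfl (Nat.cast_injective h')

/-! ### Step 4: the support consists of padded permutation patterns -/

/-- A square array of naturals with unit row and column sums is a permutation pattern. [folklore] -/
private theorem exists_perm_of_unit_sums {ι : Type*} [Fintype ι] [DecidableEq ι] (f : ι → ι → ℕ)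
    (hr : ∀ a, ∑ b, f a b = 1) (hc : ∀ b, ∑ a, f a b = 1) :
    ∃ π : Equiv.Perm ι, ∀ a b, f a b = if π b = a then 1 else 0 := by
  classical
  have hex : ∀ b, ∃ a, f a b = 1 ∧ ∀ a', a' ≠ a → f a' b = 0 :=
    fun b => exists_eq_one_of_sum_eq_one (fun a => f a b) (hc b)
  choose g hg1 hg0 using hex
  have hinj : Function.Injective g := by
    intro b b' hbb'
    by_contra hne
    have h2 : ∑ x ∈ ({b, b'} : Finset ι), f (g b) x ≤ ∑ x, f (g b) x :=
      Finset.sum_le_sum_of_subset_of_nonneg (Finset.subset_univ _) fun _ _ _ => Nat.zero_le _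
    rw [Finset.sum_pair hne, hr] at h2
    rw [hg1 b, hbb', hg1 b'] at h2
    omega
  refine ⟨Equiv.ofBijective g (Finite.injective_iff_bijective.mp hinj), fun a b => ?_⟩
  simp only [Equiv.ofBijective_apply]
  split_ifs with h
  · rw [← h]; exact hg1 b
  · exact hg0 b a (Ne.symm h)

/-- The structure of a monomial of a fixed form: outside variables absent, `X₀₀` to the power
`m - n`, and a permutation pattern on the block. [folklore] -/
private theorem exists_perm_eq_padExp [CharZero k] (hnm : n < m) {p : MvPolynomial (Fin m × Fin m) k}
    (hp : p.IsHomogeneous m)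
    (hz : ∀ z : Fin m × Fin m, z ≠ ((0 : Fin m), (0 : Fin m)) →
      ¬(m - n ≤ (z.1 : ℕ) ∧ m - n ≤ (z.2 : ℕ)) → linSubst _ k (Matrix.diagonal (zWeight z)) p = p)
    (hrc : ∀ a b : BlockIdx n m,
      linSubst _ k (Matrix.diagonal (rcWeight (a : Fin m) (b : Fin m))) p = p)
    (hy : ∀ a₀ : BlockIdx n m, linSubst _ k (Matrix.diagonal (yWeight (n := n) (a₀ : Fin m))) p = p)
    {e : (Fin m × Fin m) →₀ ℕ} (he : e ∈ p.support) :
    ∃ π : Equiv.Perm (BlockIdx n m), e = padExp π := by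
  -- outside variables are absent
  have hZ : ∀ z : Fin m × Fin m, z ≠ ((0 : Fin m), (0 : Fin m)) →
      ¬(m - n ≤ (z.1 : ℕ) ∧ m - n ≤ (z.2 : ℕ)) → e z = 0 :=
    fun z hz0 hzB => apply_eq_zero_of_fixed (hz z hz0 hzB) he
  have h0B : ¬(m - n ≤ ((0 : Fin m) : ℕ)) := by rw [Fin.val_zero]; omega
  -- row sums outside the block: only row `0` contributes, and only `e (0,0)`
  have hrow_out : ∀ i : Fin m, ¬(m - n ≤ (i : ℕ)) →
      rowSum e i = if i = 0 then e ((0 : Fin m), (0 : Fin m)) else 0 := by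
    intro i hi
    unfold rowSum
    split_ifs with hi0
    · subst hi0
      rw [Finset.sum_eq_single (0 : Fin m)]
      · intro j _ hj
        exact hZ _ (fun h => hj (Prod.mk.inj h).2) (fun h => h0B h.1)
      · intro h; exact absurd (Finset.mem_univ _) h
    · exact Finset.sum_eq_zero fun j _ => hZ _ (fun h => hi0 (Prod.mk.inj h).1) (fun h => hi h.1)
  -- total degree split along block rows / other rows
  have htot : ∑ i : Fin m, rowSum e i = m := by
    rw [← degree_eq_sum_rowSum]; exact degree_eq_of_mem_support hp he
  have hout : ∑ i : {i : Fin m // ¬(m - n ≤ (i : ℕ))}, rowSum e (i : Fin m) =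
      e ((0 : Fin m), (0 : Fin m)) := by
    rw [Finset.sum_eq_single (⟨0, h0B⟩ : {i : Fin m // ¬(m - n ≤ (i : ℕ))})]
    · rw [hrow_out _ h0B, if_pos rfl]
    · intro i _ hi
      rw [hrow_out _ i.2, if_neg (fun h => hi (Subtype.ext h))]
    · intro h; exact absurd (Finset.mem_univ _) h
  have hdeg : (∑ a : BlockIdx n m, rowSum e (a : Fin m)) + e ((0 : Fin m), (0 : Fin m)) = m := by
    have h1 := Fintype.sum_subtype_add_sum_subtype (fun i : Fin m => m - n ≤ (i : ℕ)) (rowSum e)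
    rw [hout, htot] at h1
    exact h1
  -- all block row sums and block column sums are `1`, and `e (0,0) = m - n`
  have hκ : (∀ a : BlockIdx n m, rowSum e (a : Fin m) = 1) ∧
      (∀ b : BlockIdx n m, colSum e (b : Fin m) = 1) ∧ e ((0 : Fin m), (0 : Fin m)) = m - n := by
    rcases isEmpty_or_nonempty (BlockIdx n m) with hB | hB'
    · haveI := hB
      refine ⟨fun a => hB.elim a, fun b => hB.elim b, ?_⟩
      have hn : n = 0 := by
        have hc := card_blockIdx (le_of_lt hnm)
        rw [Fintype.card_eq_zero] at hc
        exact hc.symm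
      rw [Finset.univ_eq_empty, Finset.sum_empty, zero_add] at hdeg
      rw [hdeg, hn, Nat.sub_zero]
    · obtain ⟨a₀⟩ := hB'
      have hrc' : ∀ a b : BlockIdx n m, rowSum e (a : Fin m) = colSum e (b : Fin m) :=
        fun a b => rowSum_eq_colSum _ _ (hrc a b) he
      have hrow : ∀ a : BlockIdx n m, rowSum e (a : Fin m) = rowSum e (a₀ : Fin m) :=
        fun a => by rw [hrc' a a₀, ← hrc' a₀ a₀]
      have hy0 := apply_zero_eq_of_fixed a₀ (hy a₀) he
      have hsum : ∑ a : BlockIdx n m, rowSum e (a : Fin m) = n * rowSum e (a₀ : Fin m) := by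
        rw [Finset.sum_congr rfl fun a _ => hrow a, Finset.sum_const, Finset.card_univ,
          card_blockIdx (le_of_lt hnm), smul_eq_mul]
      rw [hsum, hy0, ← add_mul, Nat.add_sub_cancel' (le_of_lt hnm)] at hdeg
      have hκ1 : rowSum e (a₀ : Fin m) = 1 := by
        have hm : 0 < m := lt_of_le_of_lt (Nat.zero_le n) hnm
        exact Nat.eq_of_mul_eq_mul_left hm (by rw [mul_one]; exact hdeg)
      refine ⟨fun a => by rw [hrow a, hκ1], fun b => by rw [← hrc' a₀ b, hκ1], ?_⟩
      rw [hy0, hκ1, mul_one]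
  obtain ⟨hrow1, hcol1, he0⟩ := hκ
  -- block restriction has unit row and column sums
  have hblock_row : ∀ a : BlockIdx n m, ∑ b : BlockIdx n m, e ((a : Fin m), (b : Fin m)) = 1 := by
    intro a
    have h1 := Fintype.sum_subtype_add_sum_subtype (fun j : Fin m => m - n ≤ (j : ℕ))
      (fun j => e ((a : Fin m), j))
    have h2 : ∑ j : {j : Fin m // ¬(m - n ≤ (j : ℕ))}, e ((a : Fin m), (j : Fin m)) = 0 :=
      Finset.sum_eq_zero fun j _ =>
        hZ _ (fun h => coe_ne_zero_of_lt hnm a (Prod.mk.inj h).1) (fun h => j.2 h.2)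
    rw [h2, add_zero] at h1
    rw [h1]
    exact hrow1 a
  have hblock_col : ∀ b : BlockIdx n m, ∑ a : BlockIdx n m, e ((a : Fin m), (b : Fin m)) = 1 := by
    intro b
    have h1 := Fintype.sum_subtype_add_sum_subtype (fun i : Fin m => m - n ≤ (i : ℕ))
      (fun i => e (i, (b : Fin m)))
    have h2 : ∑ i : {i : Fin m // ¬(m - n ≤ (i : ℕ))}, e ((i : Fin m), (b : Fin m)) = 0 :=
      Finset.sum_eq_zero fun i _ =>
        hZ _ (fun h => coe_ne_zero_of_lt hnm b (Prod.mk.inj h).2) (fun h => i.2 h.1)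
    rw [h2, add_zero] at h1
    rw [h1]
    exact hcol1 b
  obtain ⟨π, hπ⟩ := exists_perm_of_unit_sums (fun a b : BlockIdx n m => e ((a : Fin m), (b : Fin m)))
    hblock_row hblock_col
  refine ⟨π, ?_⟩
  ext ⟨i, j⟩
  rw [padExp_apply]
  by_cases hj : m - n ≤ (j : ℕ)
  · rw [dif_pos hj]
    by_cases hi : m - n ≤ (i : ℕ)
    · have hij0 : ((i, j) : Fin m × Fin m) ≠ ((0 : Fin m), (0 : Fin m)) :=
        blockVar_ne_zero hnm ⟨i, hi⟩ ⟨j, hj⟩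
      rw [if_neg hij0, zero_add]
      have hval : e (i, j) = if π ⟨j, hj⟩ = ⟨i, hi⟩ then 1 else 0 := hπ ⟨i, hi⟩ ⟨j, hj⟩
      rw [hval]
      by_cases hπ' : π ⟨j, hj⟩ = ⟨i, hi⟩
      · rw [if_pos hπ', if_pos (by rw [hπ'])]
      · rw [if_neg hπ', if_neg (fun h => hπ' (Subtype.ext h))]
    · have hij0 : ((i, j) : Fin m × Fin m) ≠ ((0 : Fin m), (0 : Fin m)) :=
        fun h => coe_ne_zero_of_lt hnm ⟨j, hj⟩ (Prod.mk.inj h).2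
      rw [if_neg hij0, zero_add,
        if_neg (fun h : ((π ⟨j, hj⟩ : BlockIdx n m) : Fin m) = i => hi (by rw [← h]; exact (π ⟨j, hj⟩).2))]
      exact hZ _ hij0 (fun h => hi h.1)
  · rw [dif_neg hj, add_zero]
    by_cases hij0 : ((i, j) : Fin m × Fin m) = ((0 : Fin m), (0 : Fin m))
    · rw [if_pos hij0, hij0, he0]
    · rw [if_neg hij0]
      exact hZ _ hij0 (fun h => hj h.2)

/-- A form supported on padded permutation patterns is the sum of its padded monomials. [folklore] -/
private theorem eq_sum_monomial_padExp (hnm : n < m) {p : MvPolynomial (Fin m × Fin m) k}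
    (hsupp : ∀ e ∈ p.support, ∃ π : Equiv.Perm (BlockIdx n m), e = padExp π) :
    p = ∑ π : Equiv.Perm (BlockIdx n m), monomial (padExp π) (coeff (padExp π) p) := by
  classical
  refine MvPolynomial.ext _ _ fun e => ?_
  rw [coeff_sum]
  simp only [coeff_monomial]
  by_cases he : ∃ π : Equiv.Perm (BlockIdx n m), e = padExp π
  · obtain ⟨π, rfl⟩ := he
    rw [Finset.sum_eq_single π]
    · rw [if_pos rfl]
    · intro π' _ hne
      rw [if_neg (fun h => hne (padExp_injective hnm h))]
    · intro h; exact absurd (Finset.mem_univ π) h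
  · rw [Finset.sum_eq_zero (fun π _ => if_neg (fun h => he ⟨π, h.symm⟩))]
    by_contra hne
    exact he (hsupp e (mem_support_iff.mpr hne))

/-! ### Step 5: block row permutations equalise the coefficients -/

/-- Block row permutation of a padded pattern: `padExp π ↦ padExp (τ π)` (the permutation of
`Fin m` extends `τ` by the identity off the block, so fixes `X₀₀` when `n < m`). [folklore] -/
private theorem mapDomain_rowPerm_padExp (hnm : n < m) (τ π : Equiv.Perm (BlockIdx n m)) :
    Finsupp.mapDomain (rowPerm (Equiv.Perm.ofSubtype τ)) (padExp π) = padExp (τ * π) := by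
  have h0B : ¬(m - n ≤ ((0 : Fin m) : ℕ)) := by rw [Fin.val_zero]; omega
  have h0 : (rowPerm (Equiv.Perm.ofSubtype τ)) ((0 : Fin m), (0 : Fin m)) = ((0 : Fin m), (0 : Fin m)) := by
    rw [rowPerm_apply, Equiv.Perm.ofSubtype_apply_of_not_mem τ h0B]
  unfold padExp
  rw [Finsupp.mapDomain_add, Finsupp.mapDomain_single, Finsupp.mapDomain_finsetSum, h0]
  simp only [Finsupp.mapDomain_single, rowPerm_apply, Equiv.Perm.mul_apply,
    Equiv.Perm.ofSubtype_apply_coe]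

/-- Block row permutation of a padded monomial. [folklore] -/
private theorem rename_rowPerm_monomial_padExp (hnm : n < m) (τ π : Equiv.Perm (BlockIdx n m)) (c : k) :
    rename (rowPerm (Equiv.Perm.ofSubtype τ)) (monomial (padExp π) c) = monomial (padExp (τ * π)) c := by
  rw [rename_monomial, mapDomain_rowPerm_padExp hnm]

/-- Block row permutations fix the padded permanent. [folklore] -/
private theorem rename_rowPerm_paddedPerPoly (hnm : n < m) (τ : Equiv.Perm (BlockIdx n m)) :
    rename (rowPerm (Equiv.Perm.ofSubtype τ)) (paddedPerPoly k n m) = paddedPerPoly k n m := by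
  rw [paddedPerPoly_eq_sum, map_sum]
  simp_rw [rename_rowPerm_monomial_padExp hnm]
  exact Fintype.sum_equiv (Equiv.mulLeft τ) _ _ fun π => rfl

/-- Coefficients of padded monomials after a block row permutation. [folklore] -/
private theorem coeff_padExp_rename_rowPerm (hnm : n < m) (τ π : Equiv.Perm (BlockIdx n m))
    (p : MvPolynomial (Fin m × Fin m) k) :
    coeff (padExp (τ * π)) (rename (rowPerm (Equiv.Perm.ofSubtype τ)) p) = coeff (padExp π) p := by
  rw [← mapDomain_rowPerm_padExp hnm]
  exact coeff_rename_mapDomain _ (rowPerm _).injective _ _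

/-! ### The characterization -/

/-- **The padded permanent is characterized by its stabilizer — proof** (Mulmuley–Sohoni, *GCT:
Introduction*, Lecture 13, Prop. [GCT1](3): "`f = φ(h) ∈ P(V)` is also characterized by its
stabilizer", `φ(h) = y^{m-n} perm(X)`; GCT II Thm. 2.3), over any field of characteristic zero and
in the tree's conventions: for `n < m`, a form of degree `m` in the `m²` matrix variables fixed by
every `γ ∈ GL_{m²}` that fixes `X₀₀^{m-n} · per_n` (`per_n` on the bottom-right block) is a scalar
multiple of it. Proof (elementary, not MS's): scaling one variable outside `{X₀₀} ∪ block` fixes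
the padded permanent, so such variables are absent from every monomial; the block row/column
scalings of clause (2) make all block row and column sums of an exponent matrix equal (`= κ`);
scaling `X₀₀ ↦ 2X₀₀` and one block row by `2^{-(m-n)}` gives `e₀₀ = (m-n)κ`, so the degree count
`m = (m-n)κ + nκ` forces `κ = 1`: every monomial is `X₀₀^{m-n}` times a block permutation monomial;
block row permutations (extended by the identity) force equal coefficients.
[cite: MulmuleySohoniGCTIntro2007, Lecture 13, Prop. [GCT1](3)]
[cite: MulmuleySohoniGCT2SIAM2008, Thm. 2.3 (arXiv cs/0612134 Thm. 3.3)] -/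
theorem paddedPerPoly_eq_smul_of_fixed [CharZero k] (hnm : n < m) (p : MvPolynomial (Fin m × Fin m) k)
    (hp : p.IsHomogeneous m)
    (hfix : ∀ γ : GL (Fin m × Fin m) k,
      linSubstRep _ k γ (paddedPerPoly k n m) = paddedPerPoly k n m → linSubstRep _ k γ p = p) :
    ∃ c : k, p = c • paddedPerPoly k n m := by
  have hdiag : ∀ β : Fin m × Fin m → k, ∀ hβ : ∀ x, β x ≠ 0,
      linSubst _ k (Matrix.diagonal β) (paddedPerPoly k n m) = paddedPerPoly k n m →
        linSubst _ k (Matrix.diagonal β) p = p := fun β hβ h => by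
    have h' := hfix (diagGL β hβ) (by rw [linSubstRep_diagGL, h])
    rwa [linSubstRep_diagGL] at h'
  have hz : ∀ z : Fin m × Fin m, z ≠ ((0 : Fin m), (0 : Fin m)) →
      ¬(m - n ≤ (z.1 : ℕ) ∧ m - n ≤ (z.2 : ℕ)) → linSubst _ k (Matrix.diagonal (zWeight z)) p = p :=
    fun z hz0 hzB => hdiag _ (zWeight_ne_zero z) (linSubst_zWeight_paddedPerPoly hz0 hzB)
  have hrc : ∀ a b : BlockIdx n m,
      linSubst _ k (Matrix.diagonal (rcWeight (a : Fin m) (b : Fin m))) p = p :=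
    fun a b => hdiag _ (rcWeight_ne_zero _ _) (linSubst_rcDiag_paddedPerPoly hnm a b)
  have hy : ∀ a₀ : BlockIdx n m,
      linSubst _ k (Matrix.diagonal (yWeight (n := n) (a₀ : Fin m))) p = p :=
    fun a₀ => hdiag _ (yWeight_ne_zero _) (linSubst_yDiag_paddedPerPoly hnm a₀)
  have hsupp : ∀ e ∈ p.support, ∃ π : Equiv.Perm (BlockIdx n m), e = padExp π :=
    fun e he => exists_perm_eq_padExp hnm hp hz hrc hy he
  have hcoeff : ∀ π : Equiv.Perm (BlockIdx n m), coeff (padExp π) p =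
      coeff (padExp (1 : Equiv.Perm (BlockIdx n m))) p := fun π => by
    have h := hfix (permGL (rowPerm (Equiv.Perm.ofSubtype π)))
      (by rw [linSubstRep_permGL, rename_rowPerm_paddedPerPoly hnm])
    rw [linSubstRep_permGL] at h
    have h2 := coeff_padExp_rename_rowPerm hnm π 1 p
    rw [mul_one, h] at h2
    exact h2
  refine ⟨coeff (padExp (1 : Equiv.Perm (BlockIdx n m))) p, ?_⟩
  conv_lhs => rw [eq_sum_monomial_padExp hnm hsupp]
  rw [paddedPerPoly_eq_sum, Finset.smul_sum]
  refine Finset.sum_congr rfl fun π _ => ?_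
  rw [hcoeff π, smul_monomial, smul_eq_mul, mul_one]

end Padded

end CharacterizedByStabilizer

/-- **The padded permanent `X₀₀^{m-n} · per_n` is characterized by its stabilizer** for
`GL_{m²}(ℂ)` acting on degree-`m` forms, `n < m` (Mulmuley–Sohoni, *GCT: Introduction*, Lecture 13,
Prop. [GCT1](3) "Finally, `f = φ(h) ∈ P(V)` is also characterized by its stabilizer"; GCT II,
Thm. 2.3 / arXiv Thm. 3.3, where `f = φ(h)` is "almost excellent"). PROVED (no named fact): see
`CharacterizedByStabilizer.paddedPerPoly_eq_smul_of_fixed`.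
[cite: MulmuleySohoniGCTIntro2007, Lecture 13, Prop. [GCT1](3)]
[cite: MulmuleySohoniGCT2SIAM2008, Thm. 2.3 (arXiv cs/0612134 Thm. 3.3)] -/
theorem paddedPerPoly_isCharacterizedByStabilizer {n m : ℕ} [NeZero m] (hnm : n < m) :
    IsCharacterizedByStabilizer (paddedPerPoly ℂ n m) m :=
  fun p hp hfix => CharacterizedByStabilizer.paddedPerPoly_eq_smul_of_fixed hnm p hp
    fun γ hγ => hfix γ (Subgroup.mem_top γ) hγ

/-- The fixed forms of the `GL_{m²}`-stabilizer of the padded permanent `X₀₀^{m-n} · per_n`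
(`n < m`) are exactly the line it spans (Mulmuley–Sohoni: "`V^{G_v̂} = ℂ v`").
[cite: MulmuleySohoniGCTIntro2007, Lecture 13, Prop. [GCT1](3)] -/
theorem fixedForms_paddedPerPoly_eq {n m : ℕ} [NeZero m] (hnm : n < m) :
    fixedForms ⊤ (paddedPerPoly ℂ n m) m = ℂ ∙ paddedPerPoly ℂ n m :=
  (paddedPerPoly_isCharacterizedByStabilizer hnm).fixedForms_eq
    (paddedPerPoly_isHomogeneous (le_of_lt hnm))

/-! ## The `SL`-reading for `per_n`, `n ≢ 1 (mod 4)`: characterized by the determinant-one stabilizer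

Companion of `CharacterizedByStabilizerSL.lean` (which REFUTES the literal `G = SL(X)` reading of
GCT II Thm. 2.3's clause "`perm(X)` … characterized by [its] stabilizer" for `n ≡ 1 (mod 4)`,
`n ≥ 5`). Here the POSITIVE half, in hypothesis form (no subgroup needed; the downstream file
restates it for `slSubgroup`): for `n` even or `n ≡ 3 (mod 4)`, a degree-`n` form fixed by every
DETERMINANT-ONE substitution fixing `per_n` is a scalar multiple of `per_n`. Same elementary
argument as `perPoly_eq_smul_of_fixed`, checking determinants: the row/column scalings
`diag(rcWeight a b)` have determinant `2^n · 2^{-n} = 1`; the row permutation `X_{ab} ↦ X_{τa,b}`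
has determinant `sgn(τ)^n` — all of them lie in `SL_{n²}` when `n` is even, the even ones when `n`
is odd; for `n ≡ 3 (mod 4)` the index transposition `X_{ab} ↦ X_{ba}` (which fixes `per_n`) has sign
`(−1)^{n(n−1)/2} = −1`, so "transpose ∘ odd row permutation" has determinant `1` and supplies the
missing identifications of coefficients (`c_{(τπ)⁻¹} = c_π`, `τ` odd). Own elementary computation
(the printed statement being the `GL`/`SL` clause of GCT II Thm. 2.3). -/

namespace CharacterizedByStabilizer

variable {k : Type*} [Field k] {n : ℕ}

/-- The row/column scaling `diag(rcWeight a b)` has determinant `1` (`n` entries `2`, `n` entries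
`2⁻¹`). [folklore] -/
private theorem det_diagGL_rcWeight [CharZero k] (a b : Fin n) :
    Matrix.det ((diagGL (rcWeight a b) (rcWeight_ne_zero a b) : GL (Fin n × Fin n) k) :
      Matrix (Fin n × Fin n) (Fin n × Fin n) k) = 1 := by
  rw [coe_diagGL, Matrix.det_diagonal]
  simp only [rcWeight, Finset.prod_mul_distrib]
  have h1' : ∀ i : Fin n, ∏ _j : Fin n, (if i = a then (2 : k) else 1) =
      (if i = a then (2 : k) else 1) ^ n := fun i => by
    rw [Finset.prod_const, Finset.card_univ, Fintype.card_fin]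
  have h2' : ∀ j : Fin n, ∏ _i : Fin n, (if j = b then (2⁻¹ : k) else 1) =
      (if j = b then (2⁻¹ : k) else 1) ^ n := fun j => by
    rw [Finset.prod_const, Finset.card_univ, Fintype.card_fin]
  have h1 : ∏ x : Fin n × Fin n, (if x.1 = a then (2 : k) else 1) = 2 ^ n := by
    rw [Fintype.prod_prod_type]
    simp_rw [h1']
    rw [Finset.prod_pow, Finset.prod_ite_eq']
    simp
  have h2 : ∏ x : Fin n × Fin n, (if x.2 = b then (2⁻¹ : k) else 1) = 2⁻¹ ^ n := by
    rw [Fintype.prod_prod_type_right]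
    simp_rw [h2']
    rw [Finset.prod_pow, Finset.prod_ite_eq']
    simp
  rw [h1, h2, ← mul_pow, mul_inv_cancel₀ (two_ne_zero (α := k)), one_pow]

/-- `permGL θ` has determinant `sgn θ`. [folklore] -/
private theorem det_permGL {σ : Type*} [Fintype σ] [DecidableEq σ] (θ : Equiv.Perm σ) :
    Matrix.det ((permGL θ : GL σ k) : Matrix σ σ k) = ((Equiv.Perm.sign θ : ℤ) : k) := by
  rw [permGL, Matrix.GeneralLinearGroup.val_mkOfDetNeZero, Matrix.det_permutation,
    Equiv.Perm.sign_inv]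

/-- `sgn` of the row permutation `(a, b) ↦ (τ a, b)` of the `n²` indices for even `n` is `1`
(`= sgn(τ)^n`). [folklore] -/
private theorem sign_rowPerm_of_even (hn : Even n) (τ : Equiv.Perm (Fin n)) :
    Equiv.Perm.sign (rowPerm τ) = 1 := by
  rw [rowPerm, Equiv.prodCongr_refl_right, Equiv.Perm.sign_prodCongrLeft, Finset.prod_const,
    Finset.card_univ, Fintype.card_fin, Int.units_pow_eq_pow_mod_two, Nat.even_iff.mp hn, pow_zero]

/-- `sgn` of the row permutation `(a, b) ↦ (τ a, b)` for odd `n` is `sgn τ`. [folklore] -/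
private theorem sign_rowPerm_of_odd (hn : Odd n) (τ : Equiv.Perm (Fin n)) :
    Equiv.Perm.sign (rowPerm τ) = Equiv.Perm.sign τ := by
  rw [rowPerm, Equiv.prodCongr_refl_right, Equiv.Perm.sign_prodCongrLeft, Finset.prod_const,
    Finset.card_univ, Fintype.card_fin, Int.units_pow_eq_pow_mod_two, Nat.odd_iff.mp hn, pow_one]

/-- The index transposition `(a, b) ↦ (b, a)` composed with a row permutation, as a permutation of
the variables: `(a, b) ↦ (b, τ a)`. [folklore] -/
private theorem prodComm_mul_rowPerm_apply (τ : Equiv.Perm (Fin n)) (x : Fin n × Fin n) :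
    ((Equiv.prodComm (Fin n) (Fin n) : Equiv.Perm (Fin n × Fin n)) * rowPerm τ) x = (x.2, τ x.1) :=
  rfl

/-- Transposed row permutation of a permutation pattern: `permExp π ↦ permExp (τπ)⁻¹`. [folklore] -/
private theorem mapDomain_prodComm_mul_rowPerm_permExp (τ π : Equiv.Perm (Fin n)) :
    Finsupp.mapDomain ((Equiv.prodComm (Fin n) (Fin n) : Equiv.Perm (Fin n × Fin n)) * rowPerm τ)
      (permExp π) = permExp (τ * π)⁻¹ := by
  unfold permExp
  rw [Finsupp.mapDomain_finsetSum]
  simp only [Finsupp.mapDomain_single, prodComm_mul_rowPerm_apply]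
  refine Fintype.sum_equiv (τ * π) _ _ fun i => ?_
  simp [Equiv.Perm.mul_apply, Equiv.Perm.inv_def]

/-- The transposed row permutations fix the permanent. [folklore] -/
private theorem rename_prodComm_mul_rowPerm_perPoly (τ : Equiv.Perm (Fin n)) :
    rename ((Equiv.prodComm (Fin n) (Fin n) : Equiv.Perm (Fin n × Fin n)) * rowPerm τ)
      (perPoly (Fin n) k) = perPoly (Fin n) k := by
  rw [perPoly_eq_sum, map_sum]
  simp_rw [rename_monomial, mapDomain_prodComm_mul_rowPerm_permExp]
  exact Fintype.sum_equiv ((Equiv.mulLeft τ).trans (Equiv.inv _)) _ _ fun π => rfl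

/-- Coefficients of permutation monomials after a transposed row permutation. [folklore] -/
private theorem coeff_permExp_rename_prodComm_mul_rowPerm (τ π : Equiv.Perm (Fin n))
    (p : MvPolynomial (Fin n × Fin n) k) :
    coeff (permExp (τ * π)⁻¹)
      (rename ((Equiv.prodComm (Fin n) (Fin n) : Equiv.Perm (Fin n × Fin n)) * rowPerm τ) p) =
      coeff (permExp π) p := by
  rw [← mapDomain_prodComm_mul_rowPerm_permExp]
  exact coeff_rename_mapDomain _ (Equiv.injective _) _ _

/-- For `n ≡ 3 (mod 4)` the index transposition is an ODD permutation of the `n²` indices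
(an involution with the `n` diagonal fixed points: sign `(−1)^{(n²−n)/2}`, and `(n² − n)/2` is odd).
[folklore] -/
private theorem sign_prodComm_of_mod_four_eq_three (h3 : n % 4 = 3) :
    Equiv.Perm.sign (Equiv.prodComm (Fin n) (Fin n) : Equiv.Perm (Fin n × Fin n)) = -1 := by
  set θ : Equiv.Perm (Fin n × Fin n) := Equiv.prodComm (Fin n) (Fin n) with hθ
  have hsq : θ ^ 2 = 1 := by
    ext p <;> simp [hθ, pow_two, Equiv.Perm.mul_apply]
  have hfp : Fintype.card (Function.fixedPoints θ) = n := by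
    let e : Function.fixedPoints θ ≃ Fin n :=
      { toFun := fun p => p.1.1
        invFun := fun i => ⟨(i, i), Function.mem_fixedPoints_iff.mpr rfl⟩
        left_inv := by
          rintro ⟨⟨a, b⟩, hp⟩
          have hba : b = a := by
            have := congrArg Prod.fst (Function.mem_fixedPoints_iff.mp hp)
            simpa [hθ] using this
          subst hba
          rfl
        right_inv := fun i => rfl }
    simpa using Fintype.card_congr e
  obtain ⟨q, hq⟩ : ∃ q, n = 4 * q + 3 := ⟨n / 4, by omega⟩
  have hsub : n * n - n = 2 * (2 * (4 * q * q + 5 * q + 1) + 1) := by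
    subst hq
    apply Nat.sub_eq_of_eq_add
    ring
  have hdiv : (Fintype.card (Fin n × Fin n) - Fintype.card (Function.fixedPoints θ)) / 2 =
      2 * (4 * q * q + 5 * q + 1) + 1 := by
    rw [hfp, Fintype.card_prod, Fintype.card_fin, hsub, Nat.mul_div_cancel_left _ two_pos]
  rw [Equiv.Perm.sign_of_pow_two_eq_one hsq, hdiv, pow_succ, pow_mul, Int.units_sq, one_pow, one_mul]

/-- **The permanent is characterized by its determinant-one stabilizer when `n ≢ 1 (mod 4)`**
(the `G = SL(X)` reading of Mulmuley–Sohoni, GCT II, Thm. 2.3 "`perm(X) ∈ P(W)` … characterized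
by [its] stabilizer", §2: "`G = SL(Y)`, `Ĝ = GL(Y)`", in the residues where it is TRUE), over any
field of characteristic zero: if `n` is even or `n ≡ 3 (mod 4)`, a form of degree `n` in the `n²`
matrix variables fixed by every `γ ∈ GL_{n²}` with `det γ = 1` that fixes `per_n` is a scalar
multiple of `per_n`. (For `n ≡ 1 (mod 4)`, `n ≥ 5`, this FAILS: `CharacterizedByStabilizerSL.lean`.)
Proof: the row/column scalings and, for even `n`, all row permutations have determinant `1`; for
odd `n` the even row permutations do, and for `n ≡ 3 (mod 4)` so does "index transposition ∘ odd
row permutation", which identifies the coefficients of odd and even permutation monomials. Own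
elementary computation refining the cited statement.
[cite: MulmuleySohoniGCT2SIAM2008, Thm. 2.3 (arXiv cs/0612134 Thm. 3.3) and §2 (`G = SL(Y)`)] -/
theorem perPoly_eq_smul_of_fixed_of_det_eq_one [CharZero k] (hn : n % 4 ≠ 1)
    (p : MvPolynomial (Fin n × Fin n) k) (hp : p.IsHomogeneous n)
    (hfix : ∀ γ : GL (Fin n × Fin n) k,
      Matrix.det (γ : Matrix (Fin n × Fin n) (Fin n × Fin n) k) = 1 →
      linSubstRep _ k γ (perPoly (Fin n) k) = perPoly (Fin n) k → linSubstRep _ k γ p = p) :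
    ∃ c : k, p = c • perPoly (Fin n) k := by
  have hdiag : ∀ a b : Fin n, linSubst _ k (Matrix.diagonal (rcWeight a b)) p = p := fun a b => by
    have h := hfix (diagGL (rcWeight a b) (rcWeight_ne_zero a b)) (det_diagGL_rcWeight a b)
      (by rw [linSubstRep_diagGL, linSubst_rcDiag_perPoly])
    rwa [linSubstRep_diagGL] at h
  have hsupp : ∀ e ∈ p.support, ∃ π : Equiv.Perm (Fin n), e = permExp π :=
    fun e he => exists_perm_of_mem_support hp hdiag he
  -- row permutations of determinant one identify coefficients
  have hrow : ∀ τ π : Equiv.Perm (Fin n), Equiv.Perm.sign (rowPerm τ) = 1 →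
      coeff (permExp (τ * π)) p = coeff (permExp π) p := fun τ π hτ => by
    have h := hfix (permGL (rowPerm τ)) (by rw [det_permGL, hτ, Units.val_one, Int.cast_one])
      (by rw [linSubstRep_permGL, rename_rowPerm_perPoly])
    rw [linSubstRep_permGL] at h
    have h2 := coeff_permExp_rename_rowPerm τ π p
    rw [h] at h2
    exact h2
  have hcoeff : ∀ π : Equiv.Perm (Fin n), coeff (permExp π) p = coeff (permExp 1) p := by
    intro π
    rcases Nat.even_or_odd n with he | ho
    · -- `n` even: every row permutation has determinant one
      have h := hrow π 1 (sign_rowPerm_of_even he π)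
      rwa [mul_one] at h
    · -- `n` odd, hence `n ≡ 3 (mod 4)`
      have h3 : n % 4 = 3 := by have := Nat.odd_iff.mp ho; omega
      rcases Int.units_eq_one_or (Equiv.Perm.sign π) with hπ | hπ
      · have h := hrow π 1 (by rw [sign_rowPerm_of_odd ho, hπ])
        rwa [mul_one] at h
      · -- odd `π`: use "transpose ∘ row permutation by `π⁻¹`", of determinant one
        have hdet : Matrix.det ((permGL ((Equiv.prodComm (Fin n) (Fin n) :
            Equiv.Perm (Fin n × Fin n)) * rowPerm π⁻¹) : GL (Fin n × Fin n) k) :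
              Matrix (Fin n × Fin n) (Fin n × Fin n) k) = 1 := by
          rw [det_permGL, map_mul, sign_prodComm_of_mod_four_eq_three h3, sign_rowPerm_of_odd ho,
            Equiv.Perm.sign_inv, hπ, neg_mul_neg, one_mul, Units.val_one, Int.cast_one]
        have h := hfix _ hdet (by rw [linSubstRep_permGL, rename_prodComm_mul_rowPerm_perPoly])
        rw [linSubstRep_permGL] at h
        have h2 := coeff_permExp_rename_prodComm_mul_rowPerm π⁻¹ 1 p
        rw [h, mul_one, inv_inv] at h2
        exact h2
  refine ⟨coeff (permExp 1) p, ?_⟩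
  conv_lhs => rw [eq_sum_monomial_permExp hsupp]
  rw [perPoly_eq_sum, Finset.smul_sum]
  refine Finset.sum_congr rfl fun π _ => ?_
  rw [hcoeff π, smul_monomial, smul_eq_mul, mul_one]

end CharacterizedByStabilizer

/-! ## The `SL`-reading for `det_m`: characterized by the determinant-one stabilizer, every `m`

GCT II Thm. 2.3 (with `G = SL(Y)`, `V = Sym^m(Y)`): "`det(Y) ∈ P(V)` [is] characterized by [its]
stabilizer". Unlike the permanent (previous section and `CharacterizedByStabilizerSL.lean`), this
holds literally in the `SL(Y)`-reading for EVERY `m`: the generators used in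
`detPoly_eq_smul_of_fixed` — the row/column scalings `diag(rcWeight a b)` (determinant `1`) and the
signed row transpositions `X_{ab} ↦ (-1)^{[a=a₀]} X_{swap(a₀,a₁) a, b}` (determinant
`(-1)^m · sgn(swap)^m = (-1)^m (-1)^m = 1`) — already lie in `SL_{m²}`. Hypothesis form here; the
companion file restates it for `slSubgroup`. -/

namespace CharacterizedByStabilizer

variable {k : Type*} [Field k] {n : ℕ}

/-- The row negation `diag(negRowWeight a₀)` has determinant `(-1)^n`. [folklore] -/
private theorem det_diagGL_negRowWeight (a₀ : Fin n) :
    Matrix.det ((diagGL (negRowWeight a₀) (negRowWeight_ne_zero a₀) : GL (Fin n × Fin n) k) :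
      Matrix (Fin n × Fin n) (Fin n × Fin n) k) = (-1) ^ n := by
  rw [coe_diagGL, Matrix.det_diagonal]
  simp only [negRowWeight]
  have h' : ∀ i : Fin n, ∏ _j : Fin n, (if i = a₀ then (-1 : k) else 1) =
      (if i = a₀ then (-1 : k) else 1) ^ n := fun i => by
    rw [Finset.prod_const, Finset.card_univ, Fintype.card_fin]
  rw [Fintype.prod_prod_type]
  simp_rw [h']
  rw [Finset.prod_pow, Finset.prod_ite_eq']
  simp

/-- The signed row transposition `X_{ab} ↦ (-1)^{[a=a₀]} X_{swap(a₀,a₁) a, b}` has determinant `1`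
(`(-1)^n · sgn(swap)^n`). [folklore] -/
private theorem det_negRow_mul_swap {a₀ a₁ : Fin n} (hne : a₀ ≠ a₁) :
    Matrix.det (((diagGL (negRowWeight a₀) (negRowWeight_ne_zero a₀) *
      permGL (rowPerm (Equiv.swap a₀ a₁)) : GL (Fin n × Fin n) k) :
        Matrix (Fin n × Fin n) (Fin n × Fin n) k)) = 1 := by
  rw [Units.val_mul, Matrix.det_mul, det_diagGL_negRowWeight, det_permGL]
  rcases Nat.even_or_odd n with he | ho
  · rw [sign_rowPerm_of_even he, Units.val_one, Int.cast_one, mul_one, he.neg_one_pow]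
  · rw [sign_rowPerm_of_odd ho, Equiv.Perm.sign_swap hne, Units.val_neg, Units.val_one, Int.cast_neg,
      Int.cast_one, ho.neg_one_pow, neg_mul_neg, one_mul]

/-- **The determinant is characterized by its determinant-one stabilizer, for every `m`** (the
`G = SL(Y)` reading of Mulmuley–Sohoni, GCT II, Thm. 2.3: "`det(Y) ∈ P(V)` … characterized by
[its] stabilizer", `V = Sym^m(Y)`, "with the natural action of `G = SL(Y)`"), over any field of
characteristic zero: a form of degree `m` in the `m²` matrix variables fixed by every `γ ∈ GL_{m²}`
with `det γ = 1` that fixes `det_m` is a scalar multiple of `det_m`. Same proof as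
`detPoly_eq_smul_of_fixed`; the substitutions used there have determinant `1`
(`det_diagGL_rcWeight`, `det_negRow_mul_swap`). Our proof of the printed statement in its literal
reading. [cite: MulmuleySohoniGCT2SIAM2008, Thm. 2.3 (arXiv cs/0612134 Thm. 3.3) and §2 (`G = SL(Y)`)] -/
theorem detPoly_eq_smul_of_fixed_of_det_eq_one [CharZero k] (p : MvPolynomial (Fin n × Fin n) k)
    (hp : p.IsHomogeneous n)
    (hfix : ∀ γ : GL (Fin n × Fin n) k,
      Matrix.det (γ : Matrix (Fin n × Fin n) (Fin n × Fin n) k) = 1 →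
      linSubstRep _ k γ (detPoly (Fin n) k) = detPoly (Fin n) k → linSubstRep _ k γ p = p) :
    ∃ c : k, p = c • detPoly (Fin n) k := by
  have hdiag : ∀ a b : Fin n, linSubst _ k (Matrix.diagonal (rcWeight a b)) p = p := fun a b => by
    have h := hfix (diagGL (rcWeight a b) (rcWeight_ne_zero a b)) (det_diagGL_rcWeight a b)
      (by rw [linSubstRep_diagGL, linSubst_rcDiag_detPoly])
    rwa [linSubstRep_diagGL] at h
  have hsupp : ∀ e ∈ p.support, ∃ π : Equiv.Perm (Fin n), e = permExp π :=
    fun e he => exists_perm_of_mem_support hp hdiag he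
  have hswap : ∀ a₀ a₁ : Fin n, a₀ ≠ a₁ → ∀ π : Equiv.Perm (Fin n),
      coeff (permExp (Equiv.swap a₀ a₁ * π)) p = -coeff (permExp π) p := by
    intro a₀ a₁ hne π
    refine coeff_permExp_swap_mul π ?_
    have h := hfix (diagGL (negRowWeight a₀) (negRowWeight_ne_zero a₀) *
        permGL (rowPerm (Equiv.swap a₀ a₁))) (det_negRow_mul_swap hne)
      (by rw [map_mul, Module.End.mul_apply, linSubstRep_permGL, linSubstRep_diagGL,
            linSubst_negRow_rename_swap_detPoly hne])
    rwa [map_mul, Module.End.mul_apply, linSubstRep_permGL, linSubstRep_diagGL] at h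
  have hsign : ∀ π : Equiv.Perm (Fin n),
      coeff (permExp π) p = ((Equiv.Perm.sign π : ℤ) : k) * coeff (permExp 1) p := by
    intro π
    induction π using Equiv.Perm.swap_induction_on with
    | one => simp
    | swap_mul f x y hxy ih => rw [hswap x y hxy f, ih, cast_sign_swap_mul hxy, neg_mul]
  refine ⟨coeff (permExp 1) p, ?_⟩
  conv_lhs => rw [eq_sum_monomial_permExp hsupp]
  rw [detPoly_eq_sum', Finset.smul_sum]
  refine Finset.sum_congr rfl fun π _ => ?_
  rw [hsign π, smul_monomial, smul_eq_mul, mul_comm]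

end CharacterizedByStabilizer

/-! ## The `SL`-reading for the padded permanent: characterized by the determinant-one stabilizer (`m ≥ 3`)

GCT II Thm. 2.3 (`V = Sym^m(Y)` "with the natural action of `G = SL(Y)`") lists the padded
permanent `f = φ(h) = y^{m-n} perm(X)` as "only almost excellent–because its defect of partial
stability is one" `[tex:cs_0612134 main.tex L803–805]`, where "almost excellent … means: (1) the
defect of partial stability may not be zero, but will be small, and (2) the point may not be fully
characterized by the stabilizer, but almost" `[L738–742]`; the GCT Introduction, Lecture 13,
Prop. [GCT1](3) states "`f = φ(h) ∈ P(V)` is also characterized by its stabilizer" for `G = GL`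
(PROVED above, `paddedPerPoly_eq_smul_of_fixed`). This section settles the literal
`G = SL(Y) = SL_{m²}` reading for the tree's `paddedPerPoly k n m` (`n < m`): it HOLDS whenever
`m ≥ 3` — so, at the sizes treated in these two files, of the three forms of Thm. 2.3 only
`perm(X)` itself (for `n ≡ 1 (mod 4)`) separates the `SL`- from the `GL`-reading. Proof, by
reduction to the `GL` theorem: call a variable
of the `m × m` grid *free* if it is neither `X₀₀` nor a block variable (free variables do not occur
in `X₀₀^{m-n} per_n`). The scaling `z ↦ 2z`, `z' ↦ z'/2` of two free variables fixes the padded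
permanent and has determinant `1`, so every monomial of a fixed form carries one common exponent
`j` at all free variables it is compared with; the `2(m-1)` free variables of row `0` and column `0`
would contribute `2(m-1)·j > m` to the degree if `j ≥ 1` (`m ≥ 3`), hence free variables are absent
from a fixed form of degree `m`. Such a form is then fixed by every scaling `z₀ ↦ δ z₀` of one free
variable, and every `γ ∈ GL_{m²}` fixing the padded permanent is the determinant-one element
`γ · (z₀ ↦ (det γ)⁻¹ z₀)` (which also fixes it) followed by such a scaling; so the form is fixed by
the whole `GL`-stabilizer and `paddedPerPoly_eq_smul_of_fixed` applies. (At `(n, m) = (1, 2)` the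
diagonal part of the determinant-one stabilizer of `X₀₀X₁₁` also fixes `X₀₁X₁₀`, which is removed
only by the non-diagonal element `X₀₁ ↦ -X₁₀, X₁₀ ↦ X₀₁`; the degenerate sizes `m ≤ 2` are not
treated.) Own elementary argument; hypothesis form here, restated for `slSubgroup` in
`CharacterizedByStabilizerSL.lean`. -/

namespace CharacterizedByStabilizer

section PaddedSL

variable {k : Type*} [Field k] {n m : ℕ} [NeZero m]

/-- A variable of the `m × m` grid is *free* (for the padded permanent `X₀₀^{m-n} per_n`) if it is
neither the padding variable `X₀₀` nor a variable of the bottom-right block. [folklore] -/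
private def IsFree (n : ℕ) (z : Fin m × Fin m) : Prop :=
  z ≠ ((0 : Fin m), (0 : Fin m)) ∧ ¬(m - n ≤ (z.1 : ℕ) ∧ m - n ≤ (z.2 : ℕ))

/-- The entries `(0, j)`, `j ≠ 0`, of row `0` are free (`n < m`). [folklore] -/
private theorem isFree_zero_left (hnm : n < m) {j : Fin m} (hj : j ≠ 0) :
    IsFree n (((0 : Fin m), j) : Fin m × Fin m) := by
  refine ⟨fun h => hj (Prod.mk.inj h).2, fun h => ?_⟩
  have h1 := h.1
  simp only [Fin.val_zero] at h1
  omega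

/-- The entries `(i, 0)`, `i ≠ 0`, of column `0` are free (`n < m`). [folklore] -/
private theorem isFree_zero_right (hnm : n < m) {i : Fin m} (hi : i ≠ 0) :
    IsFree n ((i, (0 : Fin m)) : Fin m × Fin m) := by
  refine ⟨fun h => hi (Prod.mk.inj h).1, fun h => ?_⟩
  have h2 := h.2
  simp only [Fin.val_zero] at h2
  omega

/-- The weight scaling the variable `z` by `2` and the variable `z'` by `2⁻¹`. [folklore] -/
private def pairWeight (z z' x : Fin m × Fin m) : k :=
  (if x = z then 2 else 1) * (if x = z' then 2⁻¹ else 1)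

omit [NeZero m] in
/-- The pair-scaling weights are nonzero in characteristic zero. [folklore] -/
private theorem pairWeight_ne_zero [CharZero k] (z z' x : Fin m × Fin m) :
    pairWeight (k := k) z z' x ≠ 0 := by
  unfold pairWeight
  refine mul_ne_zero ?_ ?_ <;> split_ifs <;> simp

omit [NeZero m] in
/-- The character of the pair scaling on `X^e` is `2^{e z} · 2^{-e z'}`. [folklore] -/
private theorem prod_pairWeight_pow (z z' : Fin m × Fin m) (e : (Fin m × Fin m) →₀ ℕ) :
    ∏ x, pairWeight (k := k) z z' x ^ e x = 2 ^ e z * (2⁻¹) ^ e z' := by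
  simp only [pairWeight, mul_pow, Finset.prod_mul_distrib, ite_pow, one_pow]
  rw [Finset.prod_ite_eq', Finset.prod_ite_eq']
  simp

omit [NeZero m] in
/-- The pair scaling has determinant `2 · 2⁻¹ = 1`. [folklore] -/
private theorem det_diagGL_pairWeight [CharZero k] (z z' : Fin m × Fin m) :
    Matrix.det ((diagGL (pairWeight z z') (pairWeight_ne_zero z z') : GL (Fin m × Fin m) k) :
      Matrix (Fin m × Fin m) (Fin m × Fin m) k) = 1 := by
  rw [coe_diagGL, Matrix.det_diagonal]
  simp only [pairWeight, Finset.prod_mul_distrib]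
  rw [Finset.prod_ite_eq', Finset.prod_ite_eq']
  simp only [Finset.mem_univ, if_true]
  exact mul_inv_cancel₀ two_ne_zero

/-- The pair scaling of two free variables fixes the padded permanent. [folklore] -/
private theorem linSubst_pairWeight_paddedPerPoly {z z' : Fin m × Fin m} (hz : IsFree n z)
    (hz' : IsFree n z') :
    linSubst _ k (Matrix.diagonal (pairWeight z z')) (paddedPerPoly k n m) = paddedPerPoly k n m := by
  rw [paddedPerPoly_eq_sum, map_sum]
  refine Finset.sum_congr rfl fun π _ => ?_
  rw [linSubst_diagonal_monomial', prod_pairWeight_pow, padExp_apply_of_not_mem π hz.1 hz.2,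
    padExp_apply_of_not_mem π hz'.1 hz'.2, pow_zero, pow_zero, mul_one, one_smul]

omit [NeZero m] in
/-- Fixedness under the pair scaling equalises the two exponents on the support. [folklore] -/
private theorem apply_eq_apply_of_fixed [CharZero k] {p : MvPolynomial (Fin m × Fin m) k}
    {z z' : Fin m × Fin m} (hfix : linSubst _ k (Matrix.diagonal (pairWeight z z')) p = p)
    {e : (Fin m × Fin m) →₀ ℕ} (he : e ∈ p.support) : e z = e z' := by
  have h := prod_pow_eq_one_of_fixed hfix he
  rw [prod_pairWeight_pow, inv_pow, mul_inv_eq_one₀ (pow_ne_zero _ two_ne_zero)] at h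
  have h' : ((2 ^ e z : ℕ) : k) = ((2 ^ e z' : ℕ) : k) := by push_cast; exact h
  exact Nat.pow_right_injective le_rfl (Nat.cast_injective h')

/-- Free variables do not occur in a form of degree `m ≥ 3` fixed by the pair scalings of free
variables: the `2(m-1)` free variables of row `0` and column `0` would all carry the exponent of the
given one. [folklore] -/
private theorem apply_eq_zero_of_pair_fixed [CharZero k] (hnm : n < m) (hm : 3 ≤ m)
    {p : MvPolynomial (Fin m × Fin m) k} (hp : p.IsHomogeneous m)
    (hfix : ∀ z z' : Fin m × Fin m, IsFree n z → IsFree n z' →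
      linSubst _ k (Matrix.diagonal (pairWeight z z')) p = p)
    {e : (Fin m × Fin m) →₀ ℕ} (he : e ∈ p.support) {z : Fin m × Fin m} (hz : IsFree n z) :
    e z = 0 := by
  classical
  -- every free variable has the exponent of `z`
  have heq : ∀ x : Fin m × Fin m, IsFree n x → e x = e z :=
    fun x hx => (apply_eq_apply_of_fixed (hfix z x hz hx) he).symm
  -- the free variables of row `0` and column `0`
  set S : Finset (Fin m × Fin m) :=
    ((Finset.univ.erase (0 : Fin m)).image fun j => ((0 : Fin m), j)) ∪
      ((Finset.univ.erase (0 : Fin m)).image fun i => (i, (0 : Fin m))) with hS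
  have hSfree : ∀ x ∈ S, IsFree n x := by
    intro x hx
    rcases Finset.mem_union.mp hx with h1 | h2
    · obtain ⟨j, hj, rfl⟩ := Finset.mem_image.mp h1
      exact isFree_zero_left hnm (Finset.ne_of_mem_erase hj)
    · obtain ⟨i, hi, rfl⟩ := Finset.mem_image.mp h2
      exact isFree_zero_right hnm (Finset.ne_of_mem_erase hi)
  have hScard : S.card = (m - 1) + (m - 1) := by
    rw [hS, Finset.card_union_of_disjoint, Finset.card_image_of_injective _ (fun a b h => by
        simpa using h), Finset.card_image_of_injective _ (fun a b h => by simpa using h),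
      Finset.card_erase_of_mem (Finset.mem_univ _), Finset.card_univ, Fintype.card_fin]
    rw [Finset.disjoint_left]
    intro x h1 h2
    obtain ⟨j, hj, rfl⟩ := Finset.mem_image.mp h1
    obtain ⟨i, hi, h⟩ := Finset.mem_image.mp h2
    exact Finset.ne_of_mem_erase hi (Prod.mk.inj h).1
  have hdeg : ∑ x, e x = m := by
    rw [← Finsupp.degree_eq_sum]; exact degree_eq_of_mem_support hp he
  have hle : ((m - 1) + (m - 1)) * e z ≤ m := by
    calc ((m - 1) + (m - 1)) * e z = ∑ x ∈ S, e x := by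
            rw [Finset.sum_congr rfl fun x hx => heq x (hSfree x hx), Finset.sum_const, smul_eq_mul,
              hScard]
      _ ≤ ∑ x, e x :=
            Finset.sum_le_sum_of_subset_of_nonneg (Finset.subset_univ S) fun _ _ _ => Nat.zero_le _
      _ = m := hdeg
  rcases Nat.eq_zero_or_pos (e z) with h0 | hpos
  · exact h0
  · have h2 : (m - 1) + (m - 1) ≤ ((m - 1) + (m - 1)) * e z := Nat.le_mul_of_pos_right _ hpos
    omega

/-- The weight scaling the single variable `z₀` by `δ`. [folklore] -/
private def scaleWeight (z₀ : Fin m × Fin m) (δ : k) (x : Fin m × Fin m) : k := if x = z₀ then δ else 1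

omit [NeZero m] in
/-- The single-variable scaling weights are nonzero for `δ ≠ 0`. [folklore] -/
private theorem scaleWeight_ne_zero (z₀ : Fin m × Fin m) {δ : k} (hδ : δ ≠ 0) (x : Fin m × Fin m) :
    scaleWeight z₀ δ x ≠ 0 := by
  unfold scaleWeight; split_ifs <;> simp [hδ]

omit [NeZero m] in
/-- The character of the single-variable scaling on `X^e` is `δ^{e z₀}`. [folklore] -/
private theorem prod_scaleWeight_pow (z₀ : Fin m × Fin m) (δ : k) (e : (Fin m × Fin m) →₀ ℕ) :
    ∏ x, scaleWeight z₀ δ x ^ e x = δ ^ e z₀ := by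
  simp only [scaleWeight, ite_pow, one_pow]
  rw [Finset.prod_ite_eq']
  simp

omit [NeZero m] in
/-- The single-variable scaling has determinant `δ`. [folklore] -/
private theorem det_diagGL_scaleWeight (z₀ : Fin m × Fin m) {δ : k} (hδ : δ ≠ 0) :
    Matrix.det ((diagGL (scaleWeight z₀ δ) (scaleWeight_ne_zero z₀ hδ) : GL (Fin m × Fin m) k) :
      Matrix (Fin m × Fin m) (Fin m × Fin m) k) = δ := by
  rw [coe_diagGL, Matrix.det_diagonal]
  simp only [scaleWeight]
  rw [Finset.prod_ite_eq']
  simp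

/-- Scaling a free variable fixes the padded permanent. [folklore] -/
private theorem linSubst_scaleWeight_paddedPerPoly {z₀ : Fin m × Fin m} (hz : IsFree n z₀) (δ : k) :
    linSubst _ k (Matrix.diagonal (scaleWeight z₀ δ)) (paddedPerPoly k n m) = paddedPerPoly k n m := by
  rw [paddedPerPoly_eq_sum, map_sum]
  refine Finset.sum_congr rfl fun π _ => ?_
  rw [linSubst_diagonal_monomial', prod_scaleWeight_pow, padExp_apply_of_not_mem π hz.1 hz.2, pow_zero,
    one_smul]

omit [NeZero m] in
/-- A form none of whose monomials contains `z₀` is fixed by every scaling of `z₀`. [folklore] -/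
private theorem linSubst_scaleWeight_eq_self_of_apply_eq_zero {p : MvPolynomial (Fin m × Fin m) k}
    {z₀ : Fin m × Fin m} (hZ : ∀ e ∈ p.support, e z₀ = 0) (δ : k) :
    linSubst _ k (Matrix.diagonal (scaleWeight z₀ δ)) p = p := by
  classical
  refine MvPolynomial.ext _ _ fun e => ?_
  rw [coeff_linSubst_diagonal, prod_scaleWeight_pow]
  by_cases he : e ∈ p.support
  · rw [hZ e he, pow_zero, one_mul]
  · rw [MvPolynomial.notMem_support_iff.mp he, mul_zero]

/-- **The padded permanent is characterized by its determinant-one stabilizer, `m ≥ 3`** (the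
`G = SL(Y)` reading of Mulmuley–Sohoni, GCT II, Thm. 2.3 for `f = φ(h) = y^{m-n} perm(X)` — there
"only almost excellent–because its defect of partial stability is one" — and of the GCT
Introduction, Lecture 13, Prop. [GCT1](3) "`f = φ(h)` … is also characterized by its stabilizer"),
over any field of characteristic zero and in the tree's conventions: for `n < m`, `3 ≤ m`, a form of
degree `m` in the `m²` matrix variables fixed by every `γ ∈ GL_{m²}` with `det γ = 1` that fixes
`X₀₀^{m-n} · per_n` (`per_n` on the bottom-right block) is a scalar multiple of it. Proof: reduction
to the `GL` statement `paddedPerPoly_eq_smul_of_fixed` — determinant-one pair scalings of free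
variables and the degree count remove all free variables from a fixed form, which is then fixed by
free-variable scalings and hence by the whole `GL_{m²}`-stabilizer (`γ = (γ · (z₀ ↦ (det γ)⁻¹z₀)) ·
(z₀ ↦ (det γ) z₀)`). Own elementary argument deciding the literal reading of the cited statement;
`m ≤ 2` (i.e. `(n, m) ∈ {(0,1), (0,2), (1,2)}`) is not treated.
[cite: MulmuleySohoniGCT2SIAM2008, Thm. 2.3 (arXiv cs/0612134 Thm. 3.3) and §2 (`G = SL(Y)`)]
[cite: MulmuleySohoniGCTIntro2007, Lecture 13, Prop. [GCT1](3)] -/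
theorem paddedPerPoly_eq_smul_of_fixed_of_det_eq_one [CharZero k] (hnm : n < m) (hm : 3 ≤ m)
    (p : MvPolynomial (Fin m × Fin m) k) (hp : p.IsHomogeneous m)
    (hfix : ∀ γ : GL (Fin m × Fin m) k,
      Matrix.det (γ : Matrix (Fin m × Fin m) (Fin m × Fin m) k) = 1 →
      linSubstRep _ k γ (paddedPerPoly k n m) = paddedPerPoly k n m → linSubstRep _ k γ p = p) :
    ∃ c : k, p = c • paddedPerPoly k n m := by
  -- a free variable: `z₀ = (0, 1)`
  have h1 : ((⟨1, by omega⟩ : Fin m) : Fin m) ≠ 0 := by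
    intro h
    have := congrArg Fin.val h
    simp at this
  have hz₀ : IsFree n (((0 : Fin m), (⟨1, by omega⟩ : Fin m)) : Fin m × Fin m) :=
    isFree_zero_left hnm h1
  -- pair scalings of free variables fix `p`
  have hpair : ∀ z z' : Fin m × Fin m, IsFree n z → IsFree n z' →
      linSubst _ k (Matrix.diagonal (pairWeight z z')) p = p := fun z z' hz hz' => by
    have h := hfix (diagGL (pairWeight z z') (pairWeight_ne_zero z z')) (det_diagGL_pairWeight z z')
      (by rw [linSubstRep_diagGL, linSubst_pairWeight_paddedPerPoly hz hz'])
    rwa [linSubstRep_diagGL] at h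
  -- hence free variables are absent from `p`
  have hZ : ∀ e ∈ p.support, e ((0 : Fin m), (⟨1, by omega⟩ : Fin m)) = 0 :=
    fun e he => apply_eq_zero_of_pair_fixed hnm hm hp hpair he hz₀
  -- so `p` is fixed by every scaling of `z₀`
  have hscale : ∀ δ : k, ∀ hδ : δ ≠ 0,
      linSubstRep _ k (diagGL (scaleWeight ((0 : Fin m), (⟨1, by omega⟩ : Fin m)) δ)
        (scaleWeight_ne_zero _ hδ)) p = p := fun δ hδ => by
    rw [linSubstRep_diagGL]
    exact linSubst_scaleWeight_eq_self_of_apply_eq_zero hZ δ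
  -- and therefore by the whole `GL`-stabilizer of the padded permanent
  refine paddedPerPoly_eq_smul_of_fixed hnm p hp fun γ hγ => ?_
  set δ : k := Matrix.det (γ : Matrix (Fin m × Fin m) (Fin m × Fin m) k) with hδdef
  have hδ : δ ≠ 0 := by
    rw [hδdef, ← Matrix.GeneralLinearGroup.val_det_apply]
    exact Units.ne_zero _
  set d : GL (Fin m × Fin m) k :=
    diagGL (scaleWeight ((0 : Fin m), (⟨1, by omega⟩ : Fin m)) δ⁻¹)
      (scaleWeight_ne_zero _ (inv_ne_zero hδ)) with hd
  have hd_pad : linSubstRep _ k d (paddedPerPoly k n m) = paddedPerPoly k n m := by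
    rw [hd, linSubstRep_diagGL, linSubst_scaleWeight_paddedPerPoly hz₀]
  have hdet : Matrix.det ((γ * d : GL (Fin m × Fin m) k) : Matrix (Fin m × Fin m) (Fin m × Fin m) k)
      = 1 := by
    rw [Units.val_mul, Matrix.det_mul, hd, det_diagGL_scaleWeight _ (inv_ne_zero hδ), ← hδdef,
      mul_inv_cancel₀ hδ]
  have hγd : linSubstRep _ k (γ * d) p = p :=
    hfix (γ * d) hdet (by rw [map_mul, Module.End.mul_apply, hd_pad, hγ])
  rw [map_mul, Module.End.mul_apply, hd, hscale δ⁻¹ (inv_ne_zero hδ)] at hγd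
  exact hγd

end PaddedSL

end CharacterizedByStabilizer

end Literature.Computability.AlgebraicComplexity

/-! ## Appendix: the permanent from its monomial symmetries alone (val-lit p3, for BIJL 2018 Prop. 26)

The proof of `perPoly_eq_smul_of_fixed` uses only the row/column torus scalings
`X_{ab} ↦ 2^{[a=a₀]} 2^{-[b=b₀]} X_{ab}` and the row permutations `X_{ab} ↦ X_{τa,b}` — elements of
the MONOMIAL group `Q_n × Q_n` (pairs of monomial matrices), not of the full stabilizer. The
variant below records exactly that, for consumers whose symmetry group is the monomial group
(Bläser–Ikenmeyer–Jindal–Lysikov 2018, §7, Prop. 26: "`W = (ℂ[ℂ^{n×n}]_n)_ν` is the line spanned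
by the permanent"). -/

namespace Literature.Computability.AlgebraicComplexity

namespace CharacterizedByStabilizer

variable {k : Type*} [Field k] {n : ℕ}

/-- **The permanent from its monomial symmetries** (the proof of Mulmuley–Sohoni 2008, Thm. 2.3 /
GCT Introduction Lecture 13, Prop. [GCT1](2), with its hypothesis weakened to what it uses): over
a field of characteristic zero, a form of degree `n` in the `n²` matrix variables that is fixed by
the diagonal substitutions `X_{ab} ↦ 2^{[a=a₀]} 2^{-[b=b₀]} X_{ab}` (all `a₀, b₀`) and by the row
permutations `X_{ab} ↦ X_{τ a, b}` (all `τ`) is a scalar multiple of `per_n`.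
[cite: MulmuleySohoniGCT2SIAM2008, Thm. 2.3 (arXiv cs/0612134 Thm. 3.3)] -/
theorem perPoly_eq_smul_of_fixed_of_monomial [CharZero k] (p : MvPolynomial (Fin n × Fin n) k)
    (hp : p.IsHomogeneous n)
    (hdiag : ∀ a b : Fin n, linSubst _ k (Matrix.diagonal fun x : Fin n × Fin n =>
      (if x.1 = a then (2 : k) else 1) * (if x.2 = b then (2 : k)⁻¹ else 1)) p = p)
    (hperm : ∀ τ : Equiv.Perm (Fin n), rename (fun x : Fin n × Fin n => (τ x.1, x.2)) p = p) :
    ∃ c : k, p = c • perPoly (Fin n) k := by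
  have hdiag' : ∀ a b : Fin n, linSubst _ k (Matrix.diagonal (rcWeight a b)) p = p :=
    fun a b => hdiag a b
  have hsupp : ∀ e ∈ p.support, ∃ π : Equiv.Perm (Fin n), e = permExp π :=
    fun e he => exists_perm_of_mem_support hp hdiag' he
  have hcoeff : ∀ π : Equiv.Perm (Fin n), coeff (permExp π) p = coeff (permExp 1) p := fun π => by
    have h : rename (rowPerm π) p = p := by
      have hfun : (⇑(rowPerm π) : Fin n × Fin n → Fin n × Fin n) =
          fun x : Fin n × Fin n => (π x.1, x.2) := funext fun x => rowPerm_apply π x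
      rw [hfun]
      exact hperm π
    have h2 := coeff_permExp_rename_rowPerm π 1 p
    rw [mul_one, h] at h2
    exact h2
  refine ⟨coeff (permExp 1) p, ?_⟩
  conv_lhs => rw [eq_sum_monomial_permExp hsupp]
  rw [perPoly_eq_sum, Finset.smul_sum]
  refine Finset.sum_congr rfl fun π _ => ?_
  rw [hcoeff π, smul_monomial, smul_eq_mul, mul_one]

end CharacterizedByStabilizer

end Literature.Computability.AlgebraicComplexity
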